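import Literature.MathematicalPhysics.QuantumFieldTheory.Balaban1983to89.B9Thm34Inv
import Literature.MathematicalPhysics.QuantumFieldTheory.Balaban1983to89.B9Eq360Vprime

/-!
# `Balaban1983to89.B9Ineq366CPrime` — B9 p. 403, the bound (3.66) on the kernel of `C′(A)` DERIVED from the bounds on
# its building blocks *"in the same way as in the bounds (2.68) in [4]"*, in the block-majorant calculus of [4]; and
# *"The inverse satisfies Theorem 3.2"* with (3.65) and (3.66) no longer hypotheses

HONEST FRAMING (cell `lit-balaban`, verbatim): statement-level skeleton of published theorems with citation tags; proofs
where landed; nothing here is a claim about the Yang–Mills mass gap.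

DOCFIX (cell `lit-balaban`, seat r06 gen 15, 2026-08-22; p37 `CITELOC-SWEEP-B4B9.md` §2b page-numeral slips, text layer re-read): (3.19) is p. 393 [PDF 5] ((3.20)–(3.25) p. 394); (3.57) is p. 401 [PDF 13] ((3.58)–(3.65) p. 402, (3.65)bis–(3.68) p. 403) — the locators of (3.19), (3.57), (3.57)–(3.59) in this file corrected accordingly (4 place(s)); declarations, statements and proofs byte-identical to the tree copy of record (p251626).

CITATION HEADER (lean-in-tree rule).  T. Bałaban, *Propagators for lattice gauge theories in a background field*, Commun.
Math. Phys. **99** (1985) 389–434 [`Balaban1985BackgroundPropagators`] (cell paper B9; `paper:balaban1985-cmp99-background-propagators`,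
journal page = PDF page + 388): p. 403 [PDF 15] (the expansion printed under the label (3.65), (3.66), (3.67) and the
sentence *"The inverse satisfies Theorem 3.2"*), p. 402 [PDF 14] (3.57)–(3.59), (3.61)–(3.65), p. 397–398 [PDF 9–10]
Theorem 3.1 (3.42), Theorem 3.2 (3.48) and the remark *"Using Lemma 2.1 in [4] we may replace the factor (Lʲη)^α by
(Lʲη)^β(L^{j′}η)^γ"*, p. 393–394 [PDF 5–6] (3.18)–(3.19); [4] = T. Bałaban, *Propagators and renormalization transformations
for lattice gauge theories. II*, Commun. Math. Phys. **96** (1984) 223–250 [`Balaban1984PropagatorsII`], Lemma 2.1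
(2.60)–(2.61) p. 234, (2.51)–(2.55) p. 232, (2.68) p. 235.  Text read from the held text layer (`lit read`, pp. 9–10,
13–16) and the page renders `b2b-balaban-ref1/pages/1985-cmp99-background-propagators/…-p014/p015-x2.png`.  Cell
`lit-balaban` seat r06 gen 6 (B9 fold owner), SKELETON row `B9.Eq3.66` ((3.66)–(3.67)), with rows `B9.Eq3.62` ((3.63)–(3.65)),
`B9.Eq3.58` ((3.59)), `B9.Thm3.2`, `B9.Thm3.4` (the Sect. B step).

WHAT IS PRINTED (p. 403, «…» verbatim).  «Let us consider the operator (Q′(U)G′²(U)Q′\*(U))⁻¹. Its inverse can be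
analytically continued to configurations U′U and has the expansion Q′(U′U)G′²(U′U)Q′\*(U′U) = Q′(U)G′²(U)Q′\*(U) +
F′₂(A)G′²(U′U)Q′\*(U) + Q′(U)G′²(U′U)F′₂\*(A) + F′₂(A)G′²(U′U)F′₂\*(A) + Q′(U)G′(U′U)V′(A)G′²(U)Q′\*(U) +
Q′(U)G′²(U)V′(A)G′(U′U)Q′\*(U) + Q′(U)G′(U)V′(A)G′²(U′U)V′(A)G′(U)Q′\*(U) = Q′(U)G′²(U)Q′\*(U) + C′(A), (3.65) where the
operator C′(A) is defined by the last equality. Using the results obtained for operators building it, and Lemma 2.1 [4],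
in the same way as in the bounds (2.68) in [4], we get |C′(A; y, y′)| ≦ O(1)α₁(Lʲη)⁴(L^{j′}η)^{−d}e^{−(1/2)δ₀d(y,y′)} for
y ∈ Λ_j, y′ ∈ Λ_{j′}. (3.66)  Using Theorem 3.2 and the above bound we obtain … (3.67) thus the operators in the equality
are invertible and an inverse of the left-hand side can be expressed by a Neumann series convergent for α₁ sufficiently
small. … The inverse satisfies Theorem 3.2.»  The «results obtained for operators building it»: (3.19) (Q′, block
averages with unitary transports), (3.59) «|(F′₂ⱼ(A)λ)(y)| ≦ O(1)α₁(Q′ⱼ|λ|)(y)» and «We have a similar expansion for the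
adjoint operator … F′₂\*ⱼ(A)», Theorem 3.1 (3.42) for G′(U) and — p. 403 l. 1–9 — for G′(U′U) («we can prove all the
statements (3.42)–(3.47) of Theorem 3.1 for the operator G′(U′U), of course with different constants … We define new
constants in such a way that the statements of Theorem 3.1 hold for extended operators»), and (3.63) «|(V′(A)G′(U)λ)(x)|
≦ O(1)B₀α₁e^{−δ₀d(y,y′)}».

STATUS BEFORE THIS FILE.  (3.66) was the NAMED HYPOTHESIS `h366` of `B9Thm34Inv.ineq367_of_366_348` and of
`B9Thm34Inv.inverse_satisfies_thm32` (cell GAPS G-B9-02 narrowed: *"a by-reference, asserted-routine step kept as the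
NAMED HYPOTHESIS h366 of the printed shape"*); the expansion defining `C′(A)` is PROVED (`B9Eq360Vprime.cPrime`, `eq365b`,
r06 gen 2); the inputs exist in printed shape: (3.63) ⇐ (3.61) + (3.42)₁,₂ (`B6RandomWalkHom.b9_363_of_361`), Theorem 3.1
for G′(U′U), left entries (`B6RandomWalkHom.b9_leftEntry_of_361_365`), (3.58)–(3.59) (`B9Eq358Decomposition`,
`B9Eq358KeyEstimate`), the block-diagonal majorants of Q′/Q′\* (`B9Eq319Avg.avgOp_hasMajorantHom_b9` /
`injOp_hasMajorantHom_b9`), the (2.68) scale-sum arithmetic (`B6Ineq268`), the scale transfer (`B9Ineq347.ScaleTransfer`,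
`scaleTransfer_of_260`).

WHAT THIS FILE PROVES (theorems; three real-constant/operator definitions with bodies `kappa366`, `cornerR` and — v1.1 —
`cPrimeHom`; no `Prop` placeholders, 0 new facts; standard axioms).  SETTING = pv08's homogeneous calculus `B6RandomWalk.HasMajorant` over the
B9 geometry read as a [4] geometry (`B9Thm34Ext.toB6`): ONE carrier `W` of "points" with block map `blk : W → 𝔅`, all
seven letters `Q, Qs, F₂, F₂s, G, E, V ∈ Module.End ℝ (W → ℝ)` (the reader takes `W = T_η ⊕ 𝔅`, block map
`Sum.elim blk id`, letters embedded by `B6RandomWalkHom.emb` / `embL`), so that `C′(A)` is LITERALLY the tree's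
`B9Eq360Vprime.cPrime Q Qs F₂ F₂s G E V`.
* §1 `conv_le` — the y″-sum of two composed decaying kernels, «in the same way as in (2.68) in [4]» but in the form that
  does not accumulate losses along a word: `Σ_{y″} w₁(y)e^{−r d(y,y″)}·w₂(y″)e^{−ρ d(y″,y′)} ≦ C c₁(β) w₁(y)w₂(y) e^{−ρ d(y,y′)}`
  whenever `r ≧ ρ + (α+β)δ₀` (`αδ₀` of the left rate carries the scale transfer `w₂(y″) ↦ Cw₂(y)`, `βδ₀` pays (2.61), the
  remaining `ρ` joins the right factor through (2.54)); `scaleTransfer_one` (constant weights transfer for free).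
* §2 `hasMajorant_comp_decay` (+ `_left1`, `_right1` for an unweighted small factor on either side),
  `hasMajorant_rate_mono`, and the block-local letters `hasMajorant_local_mul` / `hasMajorant_mul_local` (a block-diagonal
  majorant `κ·𝟙[y = y′]` multiplies the partner's majorant by `κ`).
* §3 **`hasMajorant_cPrime`** — (3.66): from `hQ`/`hQs` (block-diagonal, norm `κ_Q`), `hF`/`hFs` (block-diagonal, norm
  `c_Fα₁`), `hG`/`hE` ((3.42)₁-shape `B₀(Lʲη)²e^{−δd}`, `B₁(Lʲη)²e^{−δd}`), `hVG`/`hVE` ((3.63)-shape `c_Vα₁B₀e^{−δd}`,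
  `c_Vα₁B₁e^{−δd}`), the scale transfer at `α` with constant `C` for the weight `(Lʲη)²`, (2.61) at `β`, (2.54), `d ≧ 0`:
  for every `ρ ≧ 0` with `ρ + (α+β)δ₀ ≦ δ`, `C′(A)` has the majorant **`κ₃₆₆·α₁·(Lʲη)⁴·e^{−ρ d(y,y′)}`** with
  `κ₃₆₆ = C c B₁² c_F(2κ_Q + c_Fα₁) + κ_Q² c_V C c² B₀² B₁(C+1) + κ_Q² c_V² α₁ B₀² B₁² C² c³`, `c = c₁(β)` (`kappa366`; the three
  groups = terms 1–3, 4–5, 6 of the display, the words re-associated as `E·((V′G)·G)`, `G·(G·(V′E))`, `G·((V′E)·(E·(V′G)))`);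
  `hasMajorant_cPrime_half`: the printed rate, `ρ = ½δ` under `α + β ≦ ½` (Lemma 2.1 at `δ₀ = δ`).
* §4 `cornerR` (the 𝔅-corner of an operator on the functions on `X ⊕ 𝔅`), `hasMajorant_cornerR` (a majorant for
  `Sum.elim blkX blkY` descends to the corner), `eq365_cornerR` ((3.65) on 𝔅: `L′ = L + C′(A)` for the corners, from
  `B9Eq360Vprime.eq365b`), `hasMajorant_cornerR_cPrime`, and **`ineq366_kernel`** — (3.66) IN THE PRINTED KERNEL NOTATION of
  `B9Thm34Inv` (`ker (vol g d)`, pairing weight `(L^{j′}η)^d`): `|C′(A;y,y′)| ≦ κ₃₆₆α₁(Lʲη)⁴(L^{j′}η)^{−d}e^{−ρ d(y,y′)}`.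
* §5 **`inverse_satisfies_thm32_of_parts`** — `B9Thm34Inv.inverse_satisfies_thm32` with its binders `h365` AND `h366`
  DISCHARGED (`eq365_cornerR`, `ineq366_kernel` at `ρ = ½δ₀`): from Theorem 3.2 (3.48) for `(Q′G′²Q′*)⁻¹(U)`, the
  printed-shape inputs above, (3.57), (3.65)₁,₂, Lemma 2.1 and `α₁ ≦ a₁ := (2κ₃₆₆B₀Cc₁(δ₀,½+α)c₁((½−α)δ₀,α′))⁻¹`, the operator
  `Q′(U′U)G′²(U′U)Q′*(U′U)` on 𝔅 has a two-sided inverse obeying (3.48) with `B₁′ = 2B₀c₁((½−α)δ₀,α′)`,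
  `δ₁′ = (1−α′)(½−α)δ₀` — the (3.48)-part of `B9.SectBStepPrinted` resting on Theorems 3.1/3.2 (printed shapes), (3.57)/(3.59),
  (3.63), (3.65) and Lemma 2.1 only; `kappa366_pos`/`_nonneg`.
* §6 (v1.1) THE DICTIONARY TO THE TWO-SPACE LETTERS the tree actually has (`B9Eq319Avg.avgOp`/`injOp` for Q′/Q′\* with
  their block-diagonal `B6RandomWalkHom.HasMajorantHom` majorants, F′₂/F′₂\* likewise, Theorem-3.1 majorants of G′ on the
  site functions): `cPrimeHom` = `C′(A)` as the operator on the functions on 𝔅 built from `Q′, F′₂ : sites → blocks`,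
  `Q′*, F′₂* : blocks → sites`, `G′(U), G′(U′U), V′(A)` on sites; **`cornerR_cPrime_emb`**: it IS the 𝔅-corner of
  `B9Eq360Vprime.cPrime` of the letters embedded by `B6RandomWalkHom.emb`/`embL` ((0 0; Q′ 0), (0 Q′\*; 0 0), (G′ 0; 0 0), …);
  the embedded letters inherit the two-space majorants (`hasMajorant_emb_site`, `_site_mul`, `_toBlocks`, `hasMajorant_embL_toSites`);
  hence **`hasMajorant_cPrimeHom`** / **`ineq366_kernel_hom`** — (3.66) for `cPrimeHom` from `HasMajorantHom`-inputs of the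
  form `κ_Q·𝟙[y=y′]` (literally `B9Eq319Avg.avgOp_hasMajorantHom_b9`'s conclusion), `c_Fα₁·𝟙[y=y′]`, and `HasMajorant blk`
  inputs for `G′(U)`, `G′(U′U)`, `V′G′(U)`, `V′G′(U′U)`.

SCOPE / NOT CLAIMED.  (i) `κ₃₆₆`, the thresholds and `ρ` are this file's bookkeeping of the print's `O(1)`/«½δ₀»: the rate
comes out as any `ρ ≦ δ − (α+β)δ₀` (`½δ` for `α + β ≦ ½`), where `δ` is the COMMON rate at which the four decaying inputs
are supplied — in honest constants Theorem 3.1 for G′(U′U) holds at a rate `(1−α″)δ₀ < δ₀` (`b9_leftEntry_of_361_365`), and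
the print's «½δ₀» is its standing convention of re-defined constants (p. 403 l. 4–7; cf. GAPS G-B9-21, G-B9-r06-2); no claim
of the paper depends on the value.  (ii) The block-diagonal reading of Q′, Q′\*, F′₂, F′₂\*: by (3.19)/(3.59) the value at
`y` depends on the argument on `B^j(y) = Δ(y)` only (the block map of (3.42)); `κ_Q = 1` for unitary transports is the
reader's (`B9Eq319Avg.fiber_abs_sum_le`).  (iii) (3.63) for `V′G′(U′U)` and Theorem 3.1 for `G′(U′U)` are INPUTS here (their
derivations from (3.61)/(3.65) are the cited tree theorems); so are (3.42)₁ for G′(U) and (3.48) (Theorems 3.1/3.2 =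
`B9.Thm31Printed`/`Thm32Printed`, by-reference leaves of the cell).  (iv) Real block-sup model of the 𝔤-valued functions, as
in all of the cell's B9 kernel modules (`B9Thm34Inv` docstring (iii)); the identification of the corner operators with the
`B9.SiteKernel` carriers of `B9.lean` is documentary.  (v) Nothing about analyticity in `A` («Each term of the series is an
analytic function of A», cf. `B9Eq360Vprime` §9 / `B9Eq386NeumannAnalytic`), nothing of (3.68) or Sects. C–E, no theorem of
the series' end-statement.  Value = one asserted-routine step of the printed proof of Theorem 3.4 kernel-checked with its
constants, NOT summit progress.

RELATED IN THE TREE, NOT DUPLICATED (searched 2026-08-21: `ls Balaban1983to89/ | grep -i '366\|CPrime'`, `lean search`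
'366|cPrime|h366'): `B9Thm34Inv` ((3.66)+(3.48) ⇒ (3.67) ⇒ inverse; USED BY NAME, its `h366` discharged here); `B9Eq360Vprime`
(`cPrime`, `eq365b`; USED BY NAME); `B6Ineq268` (the (2.68) scale-sum arithmetic with sharp thresholds for the symmetric
½/½ splitting — here the asymmetric splitting of §1 with the generic `ScaleTransfer` hypothesis instead, as in
`B9Thm34Inv.ineq367_of_366_348`); `B6RandomWalkHom` (two-space majorants, `emb`/`embL`, local-left/right compositions with
reach ρ, (3.63) from (3.61): the reader's tools to supply the inputs); `B9Eq319Avg` (Q′, Q′\* block-diagonal two-space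
majorants); `B9Ineq347` (`ScaleTransfer`, `scaleTransfer_of_260`); `B14Eq366ActionF2`, `B16Lem366Coupling` (other papers'
(3.66)/(366), unrelated).  None derives (3.66).
-/

noncomputable section

namespace Literature.MathematicalPhysics.QuantumFieldTheory.Balaban1983to89.B9Ineq366CPrime

open Literature.MathematicalPhysics.QuantumFieldTheory.Balaban1983to89
open Literature.MathematicalPhysics.QuantumFieldTheory.Balaban1983to89.B6RandomWalk (HasMajorant BlockSupp
  hasMajorant_mono hasMajorant_mul hasMajorant_add Triangle254 Ineq261)
open Literature.MathematicalPhysics.QuantumFieldTheory.Balaban1983to89.B9Thm34Ext (toB6)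
open Literature.MathematicalPhysics.QuantumFieldTheory.Balaban1983to89.B9Ineq347 (ScaleTransfer)

/-! ## §1  The scale-sum step of [4] (2.68) in the form used here: one composition costs `(α+β)δ₀` of the rate of the
LEFT factor and nothing else -/

section ScaleSum

variable {g : B9.Geometry} [Fintype g.Site] {R : ℝ} {H : Prop}

/-- Rate monotonicity of the exponential weight: `ρ ≦ r`, `t ≧ 0` ⟹ `e^{−rt} ≦ e^{−ρt}`. [folklore] -/
private theorem exp_rate_mono {ρ r t : ℝ} (h : ρ ≤ r) (ht : 0 ≤ t) : Real.exp (-(r * t)) ≤ Real.exp (-(ρ * t)) :=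
  Real.exp_le_exp.mpr (by nlinarith)

omit [Fintype g.Site] in
/-- The scale transfer of the p. 398 remark is free for a CONSTANT weight: `e^{−αδ₀d(y,y′)}·1 ≦ 1·1` (`αδ₀ ≧ 0`, `d ≧ 0`).
[cite: Balaban1985BackgroundPropagators, p.398 remark after (3.47)] -/
theorem scaleTransfer_one {δ₀ α : ℝ} (hαδ : 0 ≤ α * δ₀) (hdnn : ∀ a b : g.Site, 0 ≤ g.dist a b) :
    ScaleTransfer g δ₀ α 1 (fun _ => (1 : ℝ)) := by
  intro y y'
  have h : Real.exp (-(α * δ₀ * g.dist y y')) ≤ 1 := by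
    rw [Real.exp_le_one_iff]
    have := mul_nonneg hαδ (hdnn y y')
    linarith
  simpa using h

/-- **The y″-sum of two composed decaying kernels, «in the same way as in the bounds (2.68) in [4]»** (B9 p. 403; [4] =
[Balaban1984PropagatorsII] p. 235): for weights `w₁, w₂ ≧ 0` on 𝔅, a left rate `r ≧ ρ + (α+β)δ₀` and a right rate `ρ ≧ 0`,
`Σ_{y″} w₁(y)e^{−r d(y,y″)} · w₂(y″)e^{−ρ d(y″,y′)} ≦ C·c₁(β)·w₁(y)w₂(y)·e^{−ρ d(y,y′)}` — route: `e^{−r d(y,y″)} ≦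
e^{−αδ₀d(y,y″)}e^{−βδ₀d(y,y″)}e^{−ρ d(y,y″)}`; the first factor carries `w₂(y″) ↦ C·w₂(y)` (the scale transfer of the p. 398
remark, [4] (2.60)); `ρd(y,y″) + ρd(y″,y′) ≧ ρd(y,y′)` ((2.54)); the y″-sum of `e^{−βδ₀d(y,y″)}` is (2.61).
[cite: Balaban1985BackgroundPropagators, (3.66) p.403 + p.398 remark; Balaban1984PropagatorsII, (2.68) p.235 + Lemma 2.1 p.234] -/
theorem conv_le (d : ℕ) (δ₀ α β ρ r C : ℝ) (w₁ w₂ : g.Site → ℝ)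
    (hw₁ : ∀ a, 0 ≤ w₁ a) (hw₂ : ∀ a, 0 ≤ w₂ a) (hC : 0 ≤ C) (hρ : 0 ≤ ρ)
    (hr : ρ + (α + β) * δ₀ ≤ r)
    (hdnn : ∀ a b : g.Site, 0 ≤ g.dist a b) (htri : Triangle254 (toB6 g R H))
    (hST : ScaleTransfer g δ₀ α C w₂) (h261 : Ineq261 d (toB6 g R H) δ₀ β) (a b : g.Site) :
    ∑ c : g.Site, (w₁ a * Real.exp (-(r * g.dist a c))) * (w₂ c * Real.exp (-(ρ * g.dist c b)))
      ≤ C * B6.c1 d δ₀ β * (w₁ a * w₂ a) * Real.exp (-(ρ * g.dist a b)) := by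
  have hterm : ∀ c : g.Site,
      (w₁ a * Real.exp (-(r * g.dist a c))) * (w₂ c * Real.exp (-(ρ * g.dist c b))) ≤
        C * (w₁ a * w₂ a) * Real.exp (-(ρ * g.dist a b)) * Real.exp (-(β * δ₀ * g.dist a c)) := by
    intro c
    have ht := hdnn a c
    -- (i) the rate of the left factor splits: r ≧ αδ₀ + βδ₀ + ρ
    have h1 : Real.exp (-(r * g.dist a c)) ≤
        Real.exp (-(α * δ₀ * g.dist a c)) * Real.exp (-(β * δ₀ * g.dist a c)) * Real.exp (-(ρ * g.dist a c)) := by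
      rw [← Real.exp_add, ← Real.exp_add]
      refine Real.exp_le_exp.mpr ?_
      have := mul_le_mul_of_nonneg_right hr ht
      linarith
    -- (ii) the scale transfer
    have h2 : Real.exp (-(α * δ₀ * g.dist a c)) * w₂ c ≤ C * w₂ a := hST a c
    -- (iii) the triangle inequality (2.54)
    have h3 : Real.exp (-(ρ * g.dist a c)) * Real.exp (-(ρ * g.dist c b)) ≤ Real.exp (-(ρ * g.dist a b)) := by
      rw [← Real.exp_add]
      refine Real.exp_le_exp.mpr ?_
      have h' : g.dist a b ≤ g.dist a c + g.dist c b := htri a c b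
      have := mul_le_mul_of_nonneg_left h' hρ
      linarith
    have e1 := Real.exp_nonneg (-(α * δ₀ * g.dist a c))
    have e2 := Real.exp_nonneg (-(β * δ₀ * g.dist a c))
    have e3 := Real.exp_nonneg (-(ρ * g.dist a c))
    have e4 := Real.exp_nonneg (-(ρ * g.dist c b))
    calc (w₁ a * Real.exp (-(r * g.dist a c))) * (w₂ c * Real.exp (-(ρ * g.dist c b)))
        ≤ (w₁ a * (Real.exp (-(α * δ₀ * g.dist a c)) * Real.exp (-(β * δ₀ * g.dist a c)) *
            Real.exp (-(ρ * g.dist a c)))) * (w₂ c * Real.exp (-(ρ * g.dist c b))) :=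
          mul_le_mul_of_nonneg_right (mul_le_mul_of_nonneg_left h1 (hw₁ a)) (mul_nonneg (hw₂ c) e4)
      _ = w₁ a * (Real.exp (-(α * δ₀ * g.dist a c)) * w₂ c) * Real.exp (-(β * δ₀ * g.dist a c)) *
            (Real.exp (-(ρ * g.dist a c)) * Real.exp (-(ρ * g.dist c b))) := by ring
      _ ≤ w₁ a * (C * w₂ a) * Real.exp (-(β * δ₀ * g.dist a c)) * Real.exp (-(ρ * g.dist a b)) := by
          have hA : 0 ≤ w₁ a * (Real.exp (-(α * δ₀ * g.dist a c)) * w₂ c) * Real.exp (-(β * δ₀ * g.dist a c)) :=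
            mul_nonneg (mul_nonneg (hw₁ a) (mul_nonneg e1 (hw₂ c))) e2
          have hB : w₁ a * (Real.exp (-(α * δ₀ * g.dist a c)) * w₂ c) * Real.exp (-(β * δ₀ * g.dist a c)) ≤
              w₁ a * (C * w₂ a) * Real.exp (-(β * δ₀ * g.dist a c)) :=
            mul_le_mul_of_nonneg_right (mul_le_mul_of_nonneg_left h2 (hw₁ a)) e2
          exact mul_le_mul hB h3 (mul_nonneg e3 e4) (hA.trans hB)
      _ = C * (w₁ a * w₂ a) * Real.exp (-(ρ * g.dist a b)) * Real.exp (-(β * δ₀ * g.dist a c)) := by ring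
  have hpref : 0 ≤ C * (w₁ a * w₂ a) * Real.exp (-(ρ * g.dist a b)) :=
    mul_nonneg (mul_nonneg hC (mul_nonneg (hw₁ a) (hw₂ a))) (Real.exp_nonneg _)
  calc ∑ c : g.Site, (w₁ a * Real.exp (-(r * g.dist a c))) * (w₂ c * Real.exp (-(ρ * g.dist c b)))
      ≤ ∑ c : g.Site, C * (w₁ a * w₂ a) * Real.exp (-(ρ * g.dist a b)) * Real.exp (-(β * δ₀ * g.dist a c)) :=
        Finset.sum_le_sum fun c _ => hterm c
    _ = C * (w₁ a * w₂ a) * Real.exp (-(ρ * g.dist a b)) * ∑ c : g.Site, Real.exp (-(β * δ₀ * g.dist a c)) := by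
        rw [Finset.mul_sum]
    _ ≤ C * (w₁ a * w₂ a) * Real.exp (-(ρ * g.dist a b)) * B6.c1 d δ₀ β :=
        mul_le_mul_of_nonneg_left (h261 a) hpref
    _ = C * B6.c1 d δ₀ β * (w₁ a * w₂ a) * Real.exp (-(ρ * g.dist a b)) := by ring

end ScaleSum

/-! ## §2  Composition of block majorants of the shape `A·w(y)·e^{−r d(y,y′)}` ([4] (2.52)–(2.55) + §1) and the block-local
letters -/

section Composition

variable {g : B9.Geometry} [Fintype g.Site] {R : ℝ} {H : Prop} {W : Type}

/-- Weakening the rate of a (2.51)-majorant `A·w(y)·e^{−r d(y,y′)}` to `ρ ≦ r` (a larger majorant is a majorant).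
[cite: Balaban1984PropagatorsII, (2.51) p.232] -/
theorem hasMajorant_rate_mono (blk : W → g.Site) {T : Module.End ℝ (W → ℝ)} (A : ℝ) (w : g.Site → ℝ) {ρ r : ℝ}
    (hA : 0 ≤ A) (hw : ∀ a, 0 ≤ w a) (hρr : ρ ≤ r) (hdnn : ∀ a b : g.Site, 0 ≤ g.dist a b)
    (h : HasMajorant (g := toB6 g R H) blk T (fun a b => A * w a * Real.exp (-(r * g.dist a b)))) :
    HasMajorant (g := toB6 g R H) blk T (fun a b => A * w a * Real.exp (-(ρ * g.dist a b))) :=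
  hasMajorant_mono (g := toB6 g R H) blk h fun a b =>
    mul_le_mul_of_nonneg_left (exp_rate_mono hρr (hdnn a b)) (mul_nonneg hA (hw a))

/-- **Composition of two decaying block majorants** ([4] (2.52)–(2.55): *"this property is preserved under the composition
of operators possessing it"*, the y″-sum by §1): `T₁` with majorant `A₁w₁(y)e^{−r d}` (rate `r ≧ ρ + (α+β)δ₀`), `T₂` with
majorant `A₂w₂(y)e^{−ρ d}`, the scale transfer at exponent `α` with constant `C` for `w₂` and (2.61) at exponent `β` give
`T₁T₂` the majorant `A₁A₂Cc₁(β)·w₁(y)w₂(y)·e^{−ρ d(y,y′)}`.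
[cite: Balaban1984PropagatorsII, (2.52)–(2.55) p.232 + (2.68) p.235; Balaban1985BackgroundPropagators, (3.66) p.403] -/
theorem hasMajorant_comp_decay (blk : W → g.Site) (d : ℕ) (δ₀ α β ρ r C A₁ A₂ : ℝ) (w₁ w₂ : g.Site → ℝ)
    (hw₁ : ∀ a, 0 ≤ w₁ a) (hw₂ : ∀ a, 0 ≤ w₂ a) (hC : 0 ≤ C) (hA₁ : 0 ≤ A₁) (hA₂ : 0 ≤ A₂) (hρ : 0 ≤ ρ)
    (hr : ρ + (α + β) * δ₀ ≤ r) (hdnn : ∀ a b : g.Site, 0 ≤ g.dist a b)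
    (htri : Triangle254 (toB6 g R H)) (hST : ScaleTransfer g δ₀ α C w₂)
    (h261 : Ineq261 d (toB6 g R H) δ₀ β) {T₁ T₂ : Module.End ℝ (W → ℝ)}
    (h₁ : HasMajorant (g := toB6 g R H) blk T₁ (fun a b => A₁ * w₁ a * Real.exp (-(r * g.dist a b))))
    (h₂ : HasMajorant (g := toB6 g R H) blk T₂ (fun a b => A₂ * w₂ a * Real.exp (-(ρ * g.dist a b)))) :
    HasMajorant (g := toB6 g R H) blk (T₁ * T₂)
      (fun a b => (A₁ * A₂ * C * B6.c1 d δ₀ β) * (w₁ a * w₂ a) * Real.exp (-(ρ * g.dist a b))) := by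
  have hK₂ : ∀ a b : g.Site, 0 ≤ A₂ * w₂ a * Real.exp (-(ρ * g.dist a b)) := fun a b =>
    mul_nonneg (mul_nonneg hA₂ (hw₂ a)) (Real.exp_nonneg _)
  refine hasMajorant_mono (g := toB6 g R H) blk (hasMajorant_mul (g := toB6 g R H) blk h₁ h₂ hK₂) fun a b => ?_
  have hc := conv_le (R := R) (H := H) d δ₀ α β ρ r C w₁ w₂ hw₁ hw₂ hC hρ hr hdnn htri hST h261 a b
  calc ∑ c : g.Site, A₁ * w₁ a * Real.exp (-(r * g.dist a c)) * (A₂ * w₂ c * Real.exp (-(ρ * g.dist c b)))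
      = (A₁ * A₂) * ∑ c : g.Site, (w₁ a * Real.exp (-(r * g.dist a c))) * (w₂ c * Real.exp (-(ρ * g.dist c b))) := by
        rw [Finset.mul_sum]
        exact Finset.sum_congr rfl fun c _ => by ring
    _ ≤ (A₁ * A₂) * (C * B6.c1 d δ₀ β * (w₁ a * w₂ a) * Real.exp (-(ρ * g.dist a b))) :=
        mul_le_mul_of_nonneg_left hc (mul_nonneg hA₁ hA₂)
    _ = (A₁ * A₂ * C * B6.c1 d δ₀ β) * (w₁ a * w₂ a) * Real.exp (-(ρ * g.dist a b)) := by ring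

/-- Composition with an UNWEIGHTED left factor (a small factor `θ·e^{−r d}`, e.g. (3.63) for `V′G′`): `T₁T₂` has majorant
`θA₂Cc₁(β)·w₂(y)·e^{−ρ d}`. [cite: Balaban1984PropagatorsII, (2.52)–(2.55) p.232; Balaban1985BackgroundPropagators, (3.63) p.402 + (3.66) p.403] -/
theorem hasMajorant_comp_decay_left1 (blk : W → g.Site) (d : ℕ) (δ₀ α β ρ r C θ A₂ : ℝ) (w₂ : g.Site → ℝ)
    (hw₂ : ∀ a, 0 ≤ w₂ a) (hC : 0 ≤ C) (hθ : 0 ≤ θ) (hA₂ : 0 ≤ A₂) (hρ : 0 ≤ ρ)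
    (hr : ρ + (α + β) * δ₀ ≤ r) (hdnn : ∀ a b : g.Site, 0 ≤ g.dist a b)
    (htri : Triangle254 (toB6 g R H)) (hST : ScaleTransfer g δ₀ α C w₂)
    (h261 : Ineq261 d (toB6 g R H) δ₀ β) {T₁ T₂ : Module.End ℝ (W → ℝ)}
    (h₁ : HasMajorant (g := toB6 g R H) blk T₁ (fun a b => θ * Real.exp (-(r * g.dist a b))))
    (h₂ : HasMajorant (g := toB6 g R H) blk T₂ (fun a b => A₂ * w₂ a * Real.exp (-(ρ * g.dist a b)))) :
    HasMajorant (g := toB6 g R H) blk (T₁ * T₂)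
      (fun a b => (θ * A₂ * C * B6.c1 d δ₀ β) * w₂ a * Real.exp (-(ρ * g.dist a b))) := by
  have h₁' : HasMajorant (g := toB6 g R H) blk T₁
      (fun a b => θ * (fun _ : g.Site => (1 : ℝ)) a * Real.exp (-(r * g.dist a b))) :=
    hasMajorant_mono (g := toB6 g R H) blk h₁ fun a b => by simp
  have h := hasMajorant_comp_decay (R := R) (H := H) blk d δ₀ α β ρ r C θ A₂ (fun _ => (1 : ℝ)) w₂
    (fun _ => zero_le_one) hw₂ hC hθ hA₂ hρ hr hdnn htri hST h261 h₁' h₂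
  exact hasMajorant_mono (g := toB6 g R H) blk h fun a b => by simp

/-- Composition with an UNWEIGHTED right factor (`T₂` a small factor `θ·e^{−ρ d}`; no scale transfer needed):
`T₁T₂` has majorant `A₁θc₁(β)·w₁(y)·e^{−ρ d}`. [cite: Balaban1984PropagatorsII, (2.52)–(2.55) p.232; Balaban1985BackgroundPropagators, (3.63) p.402 + (3.66) p.403] -/
theorem hasMajorant_comp_decay_right1 (blk : W → g.Site) (d : ℕ) (δ₀ α β ρ r A₁ θ : ℝ) (w₁ : g.Site → ℝ)
    (hw₁ : ∀ a, 0 ≤ w₁ a) (hA₁ : 0 ≤ A₁) (hθ : 0 ≤ θ) (hρ : 0 ≤ ρ) (hαδ : 0 ≤ α * δ₀)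
    (hr : ρ + (α + β) * δ₀ ≤ r) (hdnn : ∀ a b : g.Site, 0 ≤ g.dist a b)
    (htri : Triangle254 (toB6 g R H)) (h261 : Ineq261 d (toB6 g R H) δ₀ β) {T₁ T₂ : Module.End ℝ (W → ℝ)}
    (h₁ : HasMajorant (g := toB6 g R H) blk T₁ (fun a b => A₁ * w₁ a * Real.exp (-(r * g.dist a b))))
    (h₂ : HasMajorant (g := toB6 g R H) blk T₂ (fun a b => θ * Real.exp (-(ρ * g.dist a b)))) :
    HasMajorant (g := toB6 g R H) blk (T₁ * T₂)
      (fun a b => (A₁ * θ * B6.c1 d δ₀ β) * w₁ a * Real.exp (-(ρ * g.dist a b))) := by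
  have h₂' : HasMajorant (g := toB6 g R H) blk T₂
      (fun a b => θ * (fun _ : g.Site => (1 : ℝ)) a * Real.exp (-(ρ * g.dist a b))) :=
    hasMajorant_mono (g := toB6 g R H) blk h₂ fun a b => by simp
  have h := hasMajorant_comp_decay (R := R) (H := H) blk d δ₀ α β ρ r 1 A₁ θ w₁ (fun _ => (1 : ℝ))
    hw₁ (fun _ => zero_le_one) zero_le_one hA₁ hθ hρ hr hdnn htri (scaleTransfer_one hαδ hdnn) h261 h₁ h₂'
  exact hasMajorant_mono (g := toB6 g R H) blk h fun a b => by simp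

/-- A BLOCK-LOCAL letter on the left (`Q′(U)` of (3.19), `F′₂(A)` of (3.59): the output on the block `Δ(y)` depends on the
input on `Δ(y)` only, with norm `≦ κ`): if `T₁` has the block-diagonal majorant `κ·𝟙[y = y′]` and `T₂` the majorant
`K ≧ 0`, then `T₁T₂` has majorant `κ·K`. [cite: Balaban1985BackgroundPropagators, (3.19) p.393 + (3.59) p.402; Balaban1984PropagatorsII, (2.52) p.232] -/
theorem hasMajorant_local_mul [DecidableEq g.Site] (blk : W → g.Site) (κ : ℝ) {T₁ T₂ : Module.End ℝ (W → ℝ)}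
    {K : g.Site → g.Site → ℝ} (hK : ∀ a b, 0 ≤ K a b)
    (h₁ : HasMajorant (g := toB6 g R H) blk T₁ (fun a b : g.Site => if a = b then κ else 0))
    (h₂ : HasMajorant (g := toB6 g R H) blk T₂ K) :
    HasMajorant (g := toB6 g R H) blk (T₁ * T₂) (fun a b => κ * K a b) := by
  refine hasMajorant_mono (g := toB6 g R H) blk (hasMajorant_mul (g := toB6 g R H) blk h₁ h₂ hK) fun a b =>
    le_of_eq ?_
  simp [ite_mul]

/-- A BLOCK-LOCAL letter on the right (`Q′*(U)`, `F′₂*(A)`, block-diagonal majorant `κ·𝟙[y = y′]`, `κ ≧ 0`): `T₁T₂` has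
majorant `K·κ`. [cite: Balaban1985BackgroundPropagators, (3.19) p.393 + p.402 («a similar expansion for the adjoint operator»); Balaban1984PropagatorsII, (2.52) p.232] -/
theorem hasMajorant_mul_local [DecidableEq g.Site] (blk : W → g.Site) (κ : ℝ) (hκ : 0 ≤ κ)
    {T₁ T₂ : Module.End ℝ (W → ℝ)} {K : g.Site → g.Site → ℝ}
    (h₁ : HasMajorant (g := toB6 g R H) blk T₁ K)
    (h₂ : HasMajorant (g := toB6 g R H) blk T₂ (fun a b : g.Site => if a = b then κ else 0)) :
    HasMajorant (g := toB6 g R H) blk (T₁ * T₂) (fun a b => K a b * κ) := by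
  have hK₂ : ∀ a b : g.Site, 0 ≤ (if a = b then κ else 0) := fun a b => by
    split_ifs
    · exact hκ
    · exact le_rfl
  refine hasMajorant_mono (g := toB6 g R H) blk (hasMajorant_mul (g := toB6 g R H) blk h₁ h₂ hK₂) fun a b =>
    le_of_eq ?_
  simp [mul_ite]

end Composition

/-! ## §3  (3.66) for the printed six-term sum `C′(A)` (`B9Eq360Vprime.cPrime`), from the bounds on its building blocks -/

section Ineq366

variable {g : B9.Geometry} [Fintype g.Site] [DecidableEq g.Site] {R : ℝ} {H : Prop} {W : Type}

/-- The explicit `O(1)` of (3.66) produced by the route of this file (print: *"O(1)"*, depending on d and L only): with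
`κ_Q` the block-sup norm of `Q′(U)`, `Q′*(U)` (= 1 for unitary transports), `c_F α₁` that of `F′₂(A)`, `F′₂*(A)` ((3.59)),
`c_V α₁ B` the (3.63)-constant of `V′G′` for a propagator with Theorem-3.1 constant `B`, `B₀`, `B₁` the (3.42)₁-constants of
`G′(U)`, `G′(U′U)`, `C` the scale-transfer constant for the weight `(Lʲη)²` and `c = c₁(β)` of (2.61):
`κ₃₆₆ = C c B₁² c_F (2κ_Q + c_F α₁) + κ_Q² c_V C c² B₀² B₁ (C + 1) + κ_Q² c_V² α₁ B₀² B₁² C² c³` — the three groups being the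
terms 1–3, 4–5 and 6 of the p. 403 display. [cite: Balaban1985BackgroundPropagators, (3.65)–(3.66) p.403] -/
def kappa366 (κQ cF cV B₀ B₁ C c α₁ : ℝ) : ℝ :=
  C * c * B₁ ^ 2 * cF * (2 * κQ + cF * α₁)
    + κQ ^ 2 * cV * C * c ^ 2 * B₀ ^ 2 * B₁ * (C + 1)
    + κQ ^ 2 * cV ^ 2 * α₁ * B₀ ^ 2 * B₁ ^ 2 * C ^ 2 * c ^ 3

omit [Fintype g.Site] [DecidableEq g.Site] in
/-- `κ₃₆₆ ≧ 0` for non-negative data (the `O(1)` of (3.66) is a non-negative constant).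
[cite: Balaban1985BackgroundPropagators, (3.66) p.403] -/
theorem kappa366_nonneg {κQ cF cV B₀ B₁ C c α₁ : ℝ} (hκQ : 0 ≤ κQ) (hcF : 0 ≤ cF) (hcV : 0 ≤ cV)
    (hB₁ : 0 ≤ B₁) (hC : 0 ≤ C) (hc : 0 ≤ c) (hα₁ : 0 ≤ α₁) : 0 ≤ kappa366 κQ cF cV B₀ B₁ C c α₁ := by
  unfold kappa366
  positivity

/-- **(3.66) p. 403 from the building blocks of `C′(A)`, in the block-majorant calculus of [4]** — *"Using the results
obtained for operators building it, and Lemma 2.1 [4], in the same way as in the bounds (2.68) in [4], we get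
|C′(A; y, y′)| ≦ O(1)α₁(Lʲη)⁴(L^{j′}η)^{−d}e^{−(1/2)δ₀d(y,y′)} for y ∈ Λ_j, y′ ∈ Λ_{j′}. (3.66)"*.  SETTING: all seven letters of
the p. 403 expansion are endomorphisms of the functions on ONE carrier `W` with block map `blk : W → 𝔅` (the reader takes
`W = T_η ⊕ 𝔅`: site functions and block functions side by side), and `C′(A)` is LITERALLY `B9Eq360Vprime.cPrime Q Qs F₂ F₂s G E V`
(`Q = Q′(U)`, `Qs = Q′*(U)`, `F₂ = F′₂(A)`, `F₂s = F′₂*(A)`, `G = G′(U)`, `E = G′(U′U)`, `V = V′(A)`).  INPUTS, each of printed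
shape: `hQ`/`hQs` — `Q′(U)`, `Q′*(U)` are block-local with block-sup norm `≦ κ_Q` ((3.19): averages with unitary transports,
`κ_Q = 1`); `hF`/`hFs` — (3.59) *"|(F′₂ⱼ(A)λ)(y)| ≦ O(1)α₁ …"* and *"a similar expansion for the adjoint operator"*, block-local
with norm `≦ c_F α₁`; `hG` — Theorem 3.1 (3.42)₁ for `G′(U)`: majorant `B₀(Lʲη)²e^{−δ d(y,y′)}`; `hE` — the same for `G′(U′U)`
(*"we can prove all the statements (3.42)–(3.47) of Theorem 3.1 for the operator G′(U′U), of course with different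
constants … We define new constants in such a way that the statements of Theorem 3.1 hold for extended operators"*, p. 403;
tree: `B6RandomWalkHom.b9_leftEntry_of_361_365`), constant `B₁`; `hVG`/`hVE` — (3.63) for `V′(A)G′(U)` and for `V′(A)G′(U′U)`
(tree: `B6RandomWalkHom.b9_363_of_361`), constants `c_V α₁ B₀`, `c_V α₁ B₁`; all four at a common rate `δ` (the print's
convention of re-defined constants; weaken by `hasMajorant_rate_mono`).  GEOMETRY ([4] Lemma 2.1 and (2.46)/(2.54)): the scale
transfer of the p. 398 remark at exponent `α` with constant `C` for the weight `(Lʲη)²` (`C = L²` under `L²e^{−αδ₀RM} ≦ 1`,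
`B9Ineq347.scaleTransfer_of_260`), (2.61) at exponent `β`, the triangle inequality, `d ≧ 0`.  CONCLUSION: for every output
rate `ρ ≧ 0` with `ρ + (α+β)δ₀ ≦ δ`, `C′(A)` has the majorant `κ₃₆₆·α₁·(Lʲη)⁴·e^{−ρ d(y,y′)}` (`kappa366`, explicit) — in the
pairing convention of 𝔅 this IS `|C′(A;y,y′)| ≦ κ₃₆₆α₁(Lʲη)⁴(L^{j′}η)^{−d}e^{−ρ d(y,y′)}` (`ineq366_kernel` below).  LOCATED: the
printed rate `½δ₀` is `ρ = ½δ` under `α + β ≦ ½` (`hasMajorant_cPrime_half`); the paper's `O(1)` is `κ₃₆₆` with `κ_Q = 1`.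
Route = term by term: the local letters cost their norms (`hasMajorant_local_mul`/`_mul_local`), each product of decaying
factors costs one scale transfer + one (2.61) + one triangle inequality per composition (`hasMajorant_comp_decay*`), with the
words re-associated as `E·((V′G)·G)`, `G·(G·(V′E))`, `G·((V′E)·(E·(V′G)))`.
[cite: Balaban1985BackgroundPropagators, (3.65)–(3.66) p.403 + (3.59) p.402 + (3.63) p.402 + Thm 3.1 (3.42) p.397 + p.398 remark; Balaban1984PropagatorsII, Lemma 2.1 p.234 + (2.68) p.235] -/
theorem hasMajorant_cPrime (blk : W → g.Site) (d : ℕ) (δ₀ δ α β ρ C κQ cF cV B₀ B₁ α₁ : ℝ)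
    (hκQ : 0 ≤ κQ) (hcF : 0 ≤ cF) (hcV : 0 ≤ cV) (hB₀ : 0 ≤ B₀) (hB₁ : 0 ≤ B₁) (hα₁ : 0 ≤ α₁) (hC : 0 ≤ C)
    (hρ : 0 ≤ ρ) (hαδ : 0 ≤ α * δ₀) (hβδ : 0 ≤ β * δ₀) (hr : ρ + (α + β) * δ₀ ≤ δ)
    (hdnn : ∀ a b : g.Site, 0 ≤ g.dist a b) (htri : Triangle254 (toB6 g R H))
    (hST : ScaleTransfer g δ₀ α C (fun y => g.len y ^ 2)) (h261 : Ineq261 d (toB6 g R H) δ₀ β)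
    {Q Qs F₂ F₂s G E V : Module.End ℝ (W → ℝ)}
    (hQ : HasMajorant (g := toB6 g R H) blk Q (fun a b : g.Site => if a = b then κQ else 0))
    (hQs : HasMajorant (g := toB6 g R H) blk Qs (fun a b : g.Site => if a = b then κQ else 0))
    (hF : HasMajorant (g := toB6 g R H) blk F₂ (fun a b : g.Site => if a = b then cF * α₁ else 0))
    (hFs : HasMajorant (g := toB6 g R H) blk F₂s (fun a b : g.Site => if a = b then cF * α₁ else 0))
    (hG : HasMajorant (g := toB6 g R H) blk G (fun a b => B₀ * g.len a ^ 2 * Real.exp (-(δ * g.dist a b))))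
    (hE : HasMajorant (g := toB6 g R H) blk E (fun a b => B₁ * g.len a ^ 2 * Real.exp (-(δ * g.dist a b))))
    (hVG : HasMajorant (g := toB6 g R H) blk (V * G) (fun a b => cV * α₁ * B₀ * Real.exp (-(δ * g.dist a b))))
    (hVE : HasMajorant (g := toB6 g R H) blk (V * E) (fun a b => cV * α₁ * B₁ * Real.exp (-(δ * g.dist a b)))) :
    HasMajorant (g := toB6 g R H) blk (B9Eq360Vprime.cPrime Q Qs F₂ F₂s G E V)
      (fun a b => kappa366 κQ cF cV B₀ B₁ C (B6.c1 d δ₀ β) α₁ * α₁ * g.len a ^ 4 * Real.exp (-(ρ * g.dist a b))) := by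
  have hc0 : 0 ≤ B6.c1 d δ₀ β := B6RandomWalk.c1_nonneg d δ₀ β
  have hw2 : ∀ a : g.Site, 0 ≤ g.len a ^ 2 := fun a => sq_nonneg _
  have hρδ : ρ ≤ δ := by linarith
  have hcFα : 0 ≤ cF * α₁ := mul_nonneg hcF hα₁
  -- the inputs weakened to the output rate ρ (right factors)
  have hGρ := hasMajorant_rate_mono (R := R) (H := H) blk B₀ (fun a => g.len a ^ 2) hB₀ hw2 hρδ hdnn hG
  have hEρ := hasMajorant_rate_mono (R := R) (H := H) blk B₁ (fun a => g.len a ^ 2) hB₁ hw2 hρδ hdnn hE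
  have hVGρ : HasMajorant (g := toB6 g R H) blk (V * G) (fun a b => cV * α₁ * B₀ * Real.exp (-(ρ * g.dist a b))) :=
    hasMajorant_mono (g := toB6 g R H) blk hVG fun a b =>
      mul_le_mul_of_nonneg_left (exp_rate_mono hρδ (hdnn a b)) (mul_nonneg (mul_nonneg hcV hα₁) hB₀)
  have hVEρ : HasMajorant (g := toB6 g R H) blk (V * E) (fun a b => cV * α₁ * B₁ * Real.exp (-(ρ * g.dist a b))) :=
    hasMajorant_mono (g := toB6 g R H) blk hVE fun a b =>
      mul_le_mul_of_nonneg_left (exp_rate_mono hρδ (hdnn a b)) (mul_nonneg (mul_nonneg hcV hα₁) hB₁)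
  -- G′(U′U)² (terms 1–3)
  have hEE : HasMajorant (g := toB6 g R H) blk (E * E)
      (fun a b => (B₁ * B₁ * C * B6.c1 d δ₀ β) * (g.len a ^ 2 * g.len a ^ 2) * Real.exp (-(ρ * g.dist a b))) :=
    hasMajorant_comp_decay (R := R) (H := H) blk d δ₀ α β ρ δ C B₁ B₁ (fun a => g.len a ^ 2) (fun a => g.len a ^ 2)
      hw2 hw2 hC hB₁ hB₁ hρ hr hdnn htri hST h261 hE hEρ
  have hEE0 : ∀ a b : g.Site,
      0 ≤ (B₁ * B₁ * C * B6.c1 d δ₀ β) * (g.len a ^ 2 * g.len a ^ 2) * Real.exp (-(ρ * g.dist a b)) :=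
    fun a b => by positivity
  have hT1 : HasMajorant (g := toB6 g R H) blk (F₂ * (E * E) * Qs)
      (fun a b => cF * α₁ * ((B₁ * B₁ * C * B6.c1 d δ₀ β) * (g.len a ^ 2 * g.len a ^ 2) *
        Real.exp (-(ρ * g.dist a b))) * κQ) :=
    hasMajorant_mul_local (R := R) (H := H) blk κQ hκQ (hasMajorant_local_mul (R := R) (H := H) blk (cF * α₁) hEE0 hF hEE) hQs
  have hT2 : HasMajorant (g := toB6 g R H) blk (Q * (E * E) * F₂s)
      (fun a b => κQ * ((B₁ * B₁ * C * B6.c1 d δ₀ β) * (g.len a ^ 2 * g.len a ^ 2) *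
        Real.exp (-(ρ * g.dist a b))) * (cF * α₁)) :=
    hasMajorant_mul_local (R := R) (H := H) blk (cF * α₁) hcFα
      (hasMajorant_local_mul (R := R) (H := H) blk κQ hEE0 hQ hEE) hFs
  have hT3 : HasMajorant (g := toB6 g R H) blk (F₂ * (E * E) * F₂s)
      (fun a b => cF * α₁ * ((B₁ * B₁ * C * B6.c1 d δ₀ β) * (g.len a ^ 2 * g.len a ^ 2) *
        Real.exp (-(ρ * g.dist a b))) * (cF * α₁)) :=
    hasMajorant_mul_local (R := R) (H := H) blk (cF * α₁) hcFα
      (hasMajorant_local_mul (R := R) (H := H) blk (cF * α₁) hEE0 hF hEE) hFs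
  -- term 4: Q′·G′(U′U)·(V′G′(U))·G′(U)·Q′*
  have hVGG : HasMajorant (g := toB6 g R H) blk (V * G * G)
      (fun a b => (cV * α₁ * B₀ * B₀ * C * B6.c1 d δ₀ β) * g.len a ^ 2 * Real.exp (-(ρ * g.dist a b))) :=
    hasMajorant_comp_decay_left1 (R := R) (H := H) blk d δ₀ α β ρ δ C (cV * α₁ * B₀) B₀ (fun a => g.len a ^ 2)
      hw2 hC (mul_nonneg (mul_nonneg hcV hα₁) hB₀) hB₀ hρ hr hdnn htri hST h261 hVG hGρ
  have hEVGG : HasMajorant (g := toB6 g R H) blk (E * (V * G * G))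
      (fun a b => (B₁ * (cV * α₁ * B₀ * B₀ * C * B6.c1 d δ₀ β) * C * B6.c1 d δ₀ β) *
        (g.len a ^ 2 * g.len a ^ 2) * Real.exp (-(ρ * g.dist a b))) :=
    hasMajorant_comp_decay (R := R) (H := H) blk d δ₀ α β ρ δ C B₁ (cV * α₁ * B₀ * B₀ * C * B6.c1 d δ₀ β)
      (fun a => g.len a ^ 2) (fun a => g.len a ^ 2) hw2 hw2 hC hB₁ (by positivity) hρ hr hdnn htri hST h261 hE hVGG
  have e4 : E * V * (G * G) = E * (V * G * G) := by noncomm_ring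
  have hT4in : HasMajorant (g := toB6 g R H) blk (E * V * (G * G))
      (fun a b => (B₁ * (cV * α₁ * B₀ * B₀ * C * B6.c1 d δ₀ β) * C * B6.c1 d δ₀ β) *
        (g.len a ^ 2 * g.len a ^ 2) * Real.exp (-(ρ * g.dist a b))) := by
    rw [e4]; exact hEVGG
  have hT40 : ∀ a b : g.Site, 0 ≤ (B₁ * (cV * α₁ * B₀ * B₀ * C * B6.c1 d δ₀ β) * C * B6.c1 d δ₀ β) *
      (g.len a ^ 2 * g.len a ^ 2) * Real.exp (-(ρ * g.dist a b)) := fun a b => by positivity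
  have hT4 : HasMajorant (g := toB6 g R H) blk (Q * (E * V * (G * G)) * Qs)
      (fun a b => κQ * ((B₁ * (cV * α₁ * B₀ * B₀ * C * B6.c1 d δ₀ β) * C * B6.c1 d δ₀ β) *
        (g.len a ^ 2 * g.len a ^ 2) * Real.exp (-(ρ * g.dist a b))) * κQ) :=
    hasMajorant_mul_local (R := R) (H := H) blk κQ hκQ (hasMajorant_local_mul (R := R) (H := H) blk κQ hT40 hQ hT4in) hQs
  -- term 5: Q′·G′(U)·G′(U)·(V′G′(U′U))·Q′*
  have hGVE : HasMajorant (g := toB6 g R H) blk (G * (V * E))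
      (fun a b => (B₀ * (cV * α₁ * B₁) * B6.c1 d δ₀ β) * g.len a ^ 2 * Real.exp (-(ρ * g.dist a b))) :=
    hasMajorant_comp_decay_right1 (R := R) (H := H) blk d δ₀ α β ρ δ B₀ (cV * α₁ * B₁) (fun a => g.len a ^ 2)
      hw2 hB₀ (mul_nonneg (mul_nonneg hcV hα₁) hB₁) hρ hαδ hr hdnn htri h261 hG hVEρ
  have hGGVE : HasMajorant (g := toB6 g R H) blk (G * (G * (V * E)))
      (fun a b => (B₀ * (B₀ * (cV * α₁ * B₁) * B6.c1 d δ₀ β) * C * B6.c1 d δ₀ β) *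
        (g.len a ^ 2 * g.len a ^ 2) * Real.exp (-(ρ * g.dist a b))) :=
    hasMajorant_comp_decay (R := R) (H := H) blk d δ₀ α β ρ δ C B₀ (B₀ * (cV * α₁ * B₁) * B6.c1 d δ₀ β)
      (fun a => g.len a ^ 2) (fun a => g.len a ^ 2) hw2 hw2 hC hB₀ (by positivity) hρ hr hdnn htri hST h261 hG hGVE
  have e5 : G * G * V * E = G * (G * (V * E)) := by noncomm_ring
  have hT5in : HasMajorant (g := toB6 g R H) blk (G * G * V * E)
      (fun a b => (B₀ * (B₀ * (cV * α₁ * B₁) * B6.c1 d δ₀ β) * C * B6.c1 d δ₀ β) *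
        (g.len a ^ 2 * g.len a ^ 2) * Real.exp (-(ρ * g.dist a b))) := by
    rw [e5]; exact hGGVE
  have hT50 : ∀ a b : g.Site, 0 ≤ (B₀ * (B₀ * (cV * α₁ * B₁) * B6.c1 d δ₀ β) * C * B6.c1 d δ₀ β) *
      (g.len a ^ 2 * g.len a ^ 2) * Real.exp (-(ρ * g.dist a b)) := fun a b => by positivity
  have hT5 : HasMajorant (g := toB6 g R H) blk (Q * (G * G * V * E) * Qs)
      (fun a b => κQ * ((B₀ * (B₀ * (cV * α₁ * B₁) * B6.c1 d δ₀ β) * C * B6.c1 d δ₀ β) *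
        (g.len a ^ 2 * g.len a ^ 2) * Real.exp (-(ρ * g.dist a b))) * κQ) :=
    hasMajorant_mul_local (R := R) (H := H) blk κQ hκQ (hasMajorant_local_mul (R := R) (H := H) blk κQ hT50 hQ hT5in) hQs
  -- term 6: Q′·G′(U)·(V′G′(U′U))·G′(U′U)·(V′G′(U))·Q′*
  have hEVG : HasMajorant (g := toB6 g R H) blk (E * (V * G))
      (fun a b => (B₁ * (cV * α₁ * B₀) * B6.c1 d δ₀ β) * g.len a ^ 2 * Real.exp (-(ρ * g.dist a b))) :=
    hasMajorant_comp_decay_right1 (R := R) (H := H) blk d δ₀ α β ρ δ B₁ (cV * α₁ * B₀) (fun a => g.len a ^ 2)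
      hw2 hB₁ (mul_nonneg (mul_nonneg hcV hα₁) hB₀) hρ hαδ hr hdnn htri h261 hE hVGρ
  have hVEEVG : HasMajorant (g := toB6 g R H) blk (V * E * (E * (V * G)))
      (fun a b => (cV * α₁ * B₁ * (B₁ * (cV * α₁ * B₀) * B6.c1 d δ₀ β) * C * B6.c1 d δ₀ β) * g.len a ^ 2 *
        Real.exp (-(ρ * g.dist a b))) :=
    hasMajorant_comp_decay_left1 (R := R) (H := H) blk d δ₀ α β ρ δ C (cV * α₁ * B₁)
      (B₁ * (cV * α₁ * B₀) * B6.c1 d δ₀ β) (fun a => g.len a ^ 2) hw2 hC (mul_nonneg (mul_nonneg hcV hα₁) hB₁)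
      (by positivity) hρ hr hdnn htri hST h261 hVE hEVG
  have hGVEEVG : HasMajorant (g := toB6 g R H) blk (G * (V * E * (E * (V * G))))
      (fun a b => (B₀ * (cV * α₁ * B₁ * (B₁ * (cV * α₁ * B₀) * B6.c1 d δ₀ β) * C * B6.c1 d δ₀ β) * C *
        B6.c1 d δ₀ β) * (g.len a ^ 2 * g.len a ^ 2) * Real.exp (-(ρ * g.dist a b))) :=
    hasMajorant_comp_decay (R := R) (H := H) blk d δ₀ α β ρ δ C B₀
      (cV * α₁ * B₁ * (B₁ * (cV * α₁ * B₀) * B6.c1 d δ₀ β) * C * B6.c1 d δ₀ β)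
      (fun a => g.len a ^ 2) (fun a => g.len a ^ 2) hw2 hw2 hC hB₀ (by positivity) hρ hr hdnn htri hST h261 hG hVEEVG
  have e6 : G * V * (E * E) * V * G = G * (V * E * (E * (V * G))) := by noncomm_ring
  have hT6in : HasMajorant (g := toB6 g R H) blk (G * V * (E * E) * V * G)
      (fun a b => (B₀ * (cV * α₁ * B₁ * (B₁ * (cV * α₁ * B₀) * B6.c1 d δ₀ β) * C * B6.c1 d δ₀ β) * C *
        B6.c1 d δ₀ β) * (g.len a ^ 2 * g.len a ^ 2) * Real.exp (-(ρ * g.dist a b))) := by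
    rw [e6]; exact hGVEEVG
  have hT60 : ∀ a b : g.Site, 0 ≤ (B₀ * (cV * α₁ * B₁ * (B₁ * (cV * α₁ * B₀) * B6.c1 d δ₀ β) * C * B6.c1 d δ₀ β) *
      C * B6.c1 d δ₀ β) * (g.len a ^ 2 * g.len a ^ 2) * Real.exp (-(ρ * g.dist a b)) := fun a b => by positivity
  have hT6 : HasMajorant (g := toB6 g R H) blk (Q * (G * V * (E * E) * V * G) * Qs)
      (fun a b => κQ * ((B₀ * (cV * α₁ * B₁ * (B₁ * (cV * α₁ * B₀) * B6.c1 d δ₀ β) * C * B6.c1 d δ₀ β) * C *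
        B6.c1 d δ₀ β) * (g.len a ^ 2 * g.len a ^ 2) * Real.exp (-(ρ * g.dist a b))) * κQ) :=
    hasMajorant_mul_local (R := R) (H := H) blk κQ hκQ (hasMajorant_local_mul (R := R) (H := H) blk κQ hT60 hQ hT6in) hQs
  -- the sum
  have hsum := hasMajorant_add (g := toB6 g R H) blk (hasMajorant_add (g := toB6 g R H) blk
    (hasMajorant_add (g := toB6 g R H) blk (hasMajorant_add (g := toB6 g R H) blk
    (hasMajorant_add (g := toB6 g R H) blk hT1 hT2) hT3) hT4) hT5) hT6
  unfold B9Eq360Vprime.cPrime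
  refine hasMajorant_mono (g := toB6 g R H) blk hsum fun a b => le_of_eq ?_
  simp only [kappa366]
  ring

/-- **(3.66) at the printed rate `½`**: under `α + β ≦ ½` (and `δ ≧ 0` the common input rate, Lemma 2.1 taken with
`δ₀ = δ`), the output rate may be taken `ρ = ½δ` — the printed *"e^{−(1/2)δ₀d(y,y′)}"* in the paper's convention that
`G′(U′U)` obeys Theorem 3.1 with the re-defined `δ₀`. [cite: Balaban1985BackgroundPropagators, (3.66) p.403] -/
theorem hasMajorant_cPrime_half (blk : W → g.Site) (d : ℕ) (δ α β C κQ cF cV B₀ B₁ α₁ : ℝ)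
    (hκQ : 0 ≤ κQ) (hcF : 0 ≤ cF) (hcV : 0 ≤ cV) (hB₀ : 0 ≤ B₀) (hB₁ : 0 ≤ B₁) (hα₁ : 0 ≤ α₁) (hC : 0 ≤ C)
    (hδ : 0 ≤ δ) (hα : 0 ≤ α) (hβ : 0 ≤ β) (hαβ : α + β ≤ 1 / 2)
    (hdnn : ∀ a b : g.Site, 0 ≤ g.dist a b) (htri : Triangle254 (toB6 g R H))
    (hST : ScaleTransfer g δ α C (fun y => g.len y ^ 2)) (h261 : Ineq261 d (toB6 g R H) δ β)
    {Q Qs F₂ F₂s G E V : Module.End ℝ (W → ℝ)}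
    (hQ : HasMajorant (g := toB6 g R H) blk Q (fun a b : g.Site => if a = b then κQ else 0))
    (hQs : HasMajorant (g := toB6 g R H) blk Qs (fun a b : g.Site => if a = b then κQ else 0))
    (hF : HasMajorant (g := toB6 g R H) blk F₂ (fun a b : g.Site => if a = b then cF * α₁ else 0))
    (hFs : HasMajorant (g := toB6 g R H) blk F₂s (fun a b : g.Site => if a = b then cF * α₁ else 0))
    (hG : HasMajorant (g := toB6 g R H) blk G (fun a b => B₀ * g.len a ^ 2 * Real.exp (-(δ * g.dist a b))))
    (hE : HasMajorant (g := toB6 g R H) blk E (fun a b => B₁ * g.len a ^ 2 * Real.exp (-(δ * g.dist a b))))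
    (hVG : HasMajorant (g := toB6 g R H) blk (V * G) (fun a b => cV * α₁ * B₀ * Real.exp (-(δ * g.dist a b))))
    (hVE : HasMajorant (g := toB6 g R H) blk (V * E) (fun a b => cV * α₁ * B₁ * Real.exp (-(δ * g.dist a b)))) :
    HasMajorant (g := toB6 g R H) blk (B9Eq360Vprime.cPrime Q Qs F₂ F₂s G E V)
      (fun a b => kappa366 κQ cF cV B₀ B₁ C (B6.c1 d δ β) α₁ * α₁ * g.len a ^ 4 *
        Real.exp (-(δ / 2 * g.dist a b))) :=
  hasMajorant_cPrime (R := R) (H := H) blk d δ δ α β (δ / 2) C κQ cF cV B₀ B₁ α₁ hκQ hcF hcV hB₀ hB₁ hα₁ hC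
    (by linarith) (mul_nonneg hα hδ) (mul_nonneg hβ hδ) (by nlinarith) hdnn htri hST h261 hQ hQs hF hFs hG hE hVG hVE

end Ineq366

/-! ## §4  The reading on 𝔅: site functions and block functions side by side (`W = X ⊕ 𝔅`), the 𝔅-corner of an operator,
and (3.66) in the printed kernel notation of `B9Thm34Inv` -/

section Corner

variable {g : B6.Geometry} {X Y : Type}

/-- The `Y`-corner of an endomorphism `T` of the functions on `X ⊕ Y`: feed a function on `Y` (extended by `0` on `X`),
read the output on `Y`.  For the letters of p. 403 embedded in the functions on `T_η ⊕ 𝔅` (`Q′` reads sites, writes blocks;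
`Q′*` reads blocks, writes sites; `G′`, `V′` read and write sites) the 𝔅-corner of a word `Q′⋯Q′*` is that word as an operator
on the functions on 𝔅. [folklore] -/
def cornerR (T : Module.End ℝ (X ⊕ Y → ℝ)) : Module.End ℝ (Y → ℝ) where
  toFun ν y := T (Sum.elim 0 ν) (Sum.inr y)
  map_add' ν₁ ν₂ := by
    funext y
    have h : (Sum.elim (0 : X → ℝ) (ν₁ + ν₂) : X ⊕ Y → ℝ) =
        Sum.elim (0 : X → ℝ) ν₁ + Sum.elim (0 : X → ℝ) ν₂ := by
      funext w; cases w <;> simp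
    simp [h]
  map_smul' r ν := by
    funext y
    have h : (Sum.elim (0 : X → ℝ) (r • ν) : X ⊕ Y → ℝ) = r • Sum.elim (0 : X → ℝ) ν := by
      funext w; cases w <;> simp
    simp [h]

/-- Unfolding `cornerR`. [folklore] -/
private theorem cornerR_apply (T : Module.End ℝ (X ⊕ Y → ℝ)) (ν : Y → ℝ) (y : Y) :
    cornerR T ν y = T (Sum.elim 0 ν) (Sum.inr y) := rfl

/-- The corner is additive (used on (3.65): `L′ = L + C′(A)` passes to the corners). [folklore] -/
private theorem cornerR_add (A B : Module.End ℝ (X ⊕ Y → ℝ)) : cornerR (A + B) = cornerR A + cornerR B := by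
  ext ν y
  simp [cornerR_apply]

/-- A block majorant for the block map `Sum.elim blkX blkY` descends to the `Y`-corner with the block map `blkY`:
a function on `Y` supported in the block `y′` is, extended by `0`, supported in the block `y′` of `X ⊕ Y`.
[cite: Balaban1984PropagatorsII, (2.51) p.232] -/
theorem hasMajorant_cornerR (blkX : X → g.Site) (blkY : Y → g.Site) {T : Module.End ℝ (X ⊕ Y → ℝ)}
    {K : g.Site → g.Site → ℝ} (h : HasMajorant (Sum.elim blkX blkY) T K) : HasMajorant blkY (cornerR T) K := by
  intro y' ν B hν y
  have hμ : BlockSupp (Sum.elim blkX blkY) (Sum.elim (0 : X → ℝ) ν) y' B := by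
    refine ⟨hν.nonneg, fun w hw => ?_, fun w hw => ?_⟩
    · cases w with
      | inl x => simpa using hν.nonneg
      | inr y => exact hν.bound y (by simpa using hw)
    · cases w with
      | inl x => simp
      | inr y => exact hν.off y (by simpa using hw)
  simpa [cornerR_apply] using h y' _ B hμ (Sum.inr y)

/-- **(3.65) on 𝔅**: with (3.57) `Q′(U′U) = Q′(U) + F′₂(A)`, `Q′*(U′U) = Q′*(U) + F′₂*(A)` and the two forms of (3.65) for
`E = G′(U′U)`, the 𝔅-corners satisfy `L′ = L + C′(A)` — `L = Q′G′²Q′*`, `L′ = Q′(U′U)G′²(U′U)Q′*(U′U)`, `C′(A)` the PRINTED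
sum (`B9Eq360Vprime.eq365b` + additivity of the corner): the binder `h365` of `B9Thm34Inv.factor_367` /
`inverse_satisfies_thm32` for these operators. [cite: Balaban1985BackgroundPropagators, (3.57) p.401 + (3.65) p.403] -/
theorem eq365_cornerR {Q Q' Qs Qs' F₂ F₂s G E V : Module.End ℝ (X ⊕ Y → ℝ)} (h357 : Q' = Q + F₂)
    (h357s : Qs' = Qs + F₂s) (h365l : E = G + G * V * E) (h365r : E = G + E * V * G) :
    cornerR (Q' * (E * E) * Qs') = cornerR (Q * (G * G) * Qs) + cornerR (B9Eq360Vprime.cPrime Q Qs F₂ F₂s G E V) := by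
  rw [B9Eq360Vprime.eq365b Q Q' Qs Qs' F₂ F₂s G E V h357 h357s h365l h365r, cornerR_add]

end Corner

section Kernel366

variable {g : B9.Geometry} [Fintype g.Site] [DecidableEq g.Site] {R : ℝ} {H : Prop} {X : Type}

/-- **(3.66) on 𝔅, block-majorant form.**  With the letters embedded in the functions on `X ⊕ 𝔅` (block map
`Sum.elim blk id`: a site goes to its block of (3.16)/(3.42), a block to itself), the 𝔅-corner of `C′(A)` — the operator
`C′(A)` on the functions on 𝔅 — has the majorant `κ₃₆₆α₁(Lʲη)⁴e^{−ρ d(y,y′)}` for the identity block map: pv08's form of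
*"|C′(A;y,y′)| ≦ O(1)α₁(Lʲη)⁴(L^{j′}η)^{−d}e^{−ρ d(y,y′)}"* (`B9Thm34Inv.hasMajorant_id_iff`).  Hypotheses as in
`hasMajorant_cPrime`. [cite: Balaban1985BackgroundPropagators, (3.65)–(3.66) p.403] -/
theorem hasMajorant_cornerR_cPrime (blk : X → g.Site) (d : ℕ) (δ₀ δ α β ρ C κQ cF cV B₀ B₁ α₁ : ℝ)
    (hκQ : 0 ≤ κQ) (hcF : 0 ≤ cF) (hcV : 0 ≤ cV) (hB₀ : 0 ≤ B₀) (hB₁ : 0 ≤ B₁) (hα₁ : 0 ≤ α₁) (hC : 0 ≤ C)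
    (hρ : 0 ≤ ρ) (hαδ : 0 ≤ α * δ₀) (hβδ : 0 ≤ β * δ₀) (hr : ρ + (α + β) * δ₀ ≤ δ)
    (hdnn : ∀ a b : g.Site, 0 ≤ g.dist a b) (htri : Triangle254 (toB6 g R H))
    (hST : ScaleTransfer g δ₀ α C (fun y => g.len y ^ 2)) (h261 : Ineq261 d (toB6 g R H) δ₀ β)
    {Q Qs F₂ F₂s G E V : Module.End ℝ (X ⊕ g.Site → ℝ)}
    (hQ : HasMajorant (g := toB6 g R H) (Sum.elim blk fun y : g.Site => y) Q
      (fun a b : g.Site => if a = b then κQ else 0))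
    (hQs : HasMajorant (g := toB6 g R H) (Sum.elim blk fun y : g.Site => y) Qs
      (fun a b : g.Site => if a = b then κQ else 0))
    (hF : HasMajorant (g := toB6 g R H) (Sum.elim blk fun y : g.Site => y) F₂
      (fun a b : g.Site => if a = b then cF * α₁ else 0))
    (hFs : HasMajorant (g := toB6 g R H) (Sum.elim blk fun y : g.Site => y) F₂s
      (fun a b : g.Site => if a = b then cF * α₁ else 0))
    (hG : HasMajorant (g := toB6 g R H) (Sum.elim blk fun y : g.Site => y) G
      (fun a b => B₀ * g.len a ^ 2 * Real.exp (-(δ * g.dist a b))))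
    (hE : HasMajorant (g := toB6 g R H) (Sum.elim blk fun y : g.Site => y) E
      (fun a b => B₁ * g.len a ^ 2 * Real.exp (-(δ * g.dist a b))))
    (hVG : HasMajorant (g := toB6 g R H) (Sum.elim blk fun y : g.Site => y) (V * G)
      (fun a b => cV * α₁ * B₀ * Real.exp (-(δ * g.dist a b))))
    (hVE : HasMajorant (g := toB6 g R H) (Sum.elim blk fun y : g.Site => y) (V * E)
      (fun a b => cV * α₁ * B₁ * Real.exp (-(δ * g.dist a b)))) :
    HasMajorant (g := toB6 g R H) (fun y : g.Site => y) (cornerR (B9Eq360Vprime.cPrime Q Qs F₂ F₂s G E V))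
      (fun a b => kappa366 κQ cF cV B₀ B₁ C (B6.c1 d δ₀ β) α₁ * α₁ * g.len a ^ 4 * Real.exp (-(ρ * g.dist a b))) :=
  hasMajorant_cornerR (g := toB6 g R H) blk (fun y : g.Site => y)
    (hasMajorant_cPrime (R := R) (H := H) (Sum.elim blk fun y : g.Site => y) d δ₀ δ α β ρ C κQ cF cV B₀ B₁ α₁
      hκQ hcF hcV hB₀ hB₁ hα₁ hC hρ hαδ hβδ hr hdnn htri hST h261 hQ hQs hF hFs hG hE hVG hVE)

/-- **(3.66) IN THE PRINTED KERNEL NOTATION** (the kernel `C′(A;y,y′)` with respect to the pairing `Σ_{y′}(L^{j′}η)^d(·)`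
of 𝔅, `B9Thm34Inv.ker (vol g d)`): *"|C′(A; y, y′)| ≦ O(1)α₁(Lʲη)⁴(L^{j′}η)^{−d}e^{−ρ d(y,y′)} for y ∈ Λ_j, y′ ∈ Λ_{j′}"*
with `O(1) = κ₃₆₆` and the rate `ρ` of `hasMajorant_cPrime` (`ρ = ½δ` under `α + β ≦ ½`).  Hypotheses as in
`hasMajorant_cornerR_cPrime`, plus `Lʲη > 0`. [cite: Balaban1985BackgroundPropagators, (3.66) p.403] -/
theorem ineq366_kernel (blk : X → g.Site) (d : ℕ) (δ₀ δ α β ρ C κQ cF cV B₀ B₁ α₁ : ℝ)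
    (hκQ : 0 ≤ κQ) (hcF : 0 ≤ cF) (hcV : 0 ≤ cV) (hB₀ : 0 ≤ B₀) (hB₁ : 0 ≤ B₁) (hα₁ : 0 ≤ α₁) (hC : 0 ≤ C)
    (hρ : 0 ≤ ρ) (hαδ : 0 ≤ α * δ₀) (hβδ : 0 ≤ β * δ₀) (hr : ρ + (α + β) * δ₀ ≤ δ)
    (hdnn : ∀ a b : g.Site, 0 ≤ g.dist a b) (htri : Triangle254 (toB6 g R H))
    (hlen : ∀ y : g.Site, 0 < g.len y)
    (hST : ScaleTransfer g δ₀ α C (fun y => g.len y ^ 2)) (h261 : Ineq261 d (toB6 g R H) δ₀ β)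
    {Q Qs F₂ F₂s G E V : Module.End ℝ (X ⊕ g.Site → ℝ)}
    (hQ : HasMajorant (g := toB6 g R H) (Sum.elim blk fun y : g.Site => y) Q
      (fun a b : g.Site => if a = b then κQ else 0))
    (hQs : HasMajorant (g := toB6 g R H) (Sum.elim blk fun y : g.Site => y) Qs
      (fun a b : g.Site => if a = b then κQ else 0))
    (hF : HasMajorant (g := toB6 g R H) (Sum.elim blk fun y : g.Site => y) F₂
      (fun a b : g.Site => if a = b then cF * α₁ else 0))
    (hFs : HasMajorant (g := toB6 g R H) (Sum.elim blk fun y : g.Site => y) F₂s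
      (fun a b : g.Site => if a = b then cF * α₁ else 0))
    (hG : HasMajorant (g := toB6 g R H) (Sum.elim blk fun y : g.Site => y) G
      (fun a b => B₀ * g.len a ^ 2 * Real.exp (-(δ * g.dist a b))))
    (hE : HasMajorant (g := toB6 g R H) (Sum.elim blk fun y : g.Site => y) E
      (fun a b => B₁ * g.len a ^ 2 * Real.exp (-(δ * g.dist a b))))
    (hVG : HasMajorant (g := toB6 g R H) (Sum.elim blk fun y : g.Site => y) (V * G)
      (fun a b => cV * α₁ * B₀ * Real.exp (-(δ * g.dist a b))))
    (hVE : HasMajorant (g := toB6 g R H) (Sum.elim blk fun y : g.Site => y) (V * E)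
      (fun a b => cV * α₁ * B₁ * Real.exp (-(δ * g.dist a b)))) :
    ∀ y y' : g.Site,
      |B9Thm34Inv.ker (B9Thm34Inv.vol g d) (cornerR (B9Eq360Vprime.cPrime Q Qs F₂ F₂s G E V)) y y'| ≤
        kappa366 κQ cF cV B₀ B₁ C (B6.c1 d δ₀ β) α₁ * α₁ * g.len y ^ 4 * g.len y' ^ (-(d : ℝ)) *
          Real.exp (-(ρ * g.dist y y')) := by
  intro y y'
  have hM := hasMajorant_cornerR_cPrime (R := R) (H := H) blk d δ₀ δ α β ρ C κQ cF cV B₀ B₁ α₁ hκQ hcF hcV hB₀ hB₁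
    hα₁ hC hρ hαδ hβδ hr hdnn htri hST h261 hQ hQs hF hFs hG hE hVG hVE
  have hent := (B9Thm34Inv.hasMajorant_id_iff (R := R) (H := H) _ _).mp hM y y'
  have hk := (B9Thm34Inv.ker_le_iff (B9Thm34Inv.vol g d) (B9Thm34Inv.vol_pos d hlen y') _ y _).mpr hent
  rw [B9Thm34Inv.vol_inv d hlen] at hk
  calc |B9Thm34Inv.ker (B9Thm34Inv.vol g d) (cornerR (B9Eq360Vprime.cPrime Q Qs F₂ F₂s G E V)) y y'|
      ≤ kappa366 κQ cF cV B₀ B₁ C (B6.c1 d δ₀ β) α₁ * α₁ * g.len y ^ 4 * Real.exp (-(ρ * g.dist y y')) *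
          g.len y' ^ (-(d : ℝ)) := hk
    _ = _ := by ring

end Kernel366

/-! ## §5  *"The inverse satisfies Theorem 3.2"* (p. 403) with (3.65) AND (3.66) discharged: the `(Q′G′²Q′*)⁻¹`-part of the
Sect. B step from Theorem-3.1/3.2-shaped inputs, (3.59), (3.63) and Lemma 2.1 only -/

section SectBStep

variable {g : B9.Geometry} [Fintype g.Site] [DecidableEq g.Site] {R : ℝ} {H : Prop} {X : Type}

omit [Fintype g.Site] [DecidableEq g.Site] in
/-- `κ₃₆₆ > 0` as soon as `κ_Q, c_F, B₁, C, c > 0` (the threshold `a₁` below is a reciprocal of the `O(1)` of (3.66)).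
[cite: Balaban1985BackgroundPropagators, (3.66)–(3.67) p.403] -/
theorem kappa366_pos {κQ cF cV B₀ B₁ C c α₁ : ℝ} (hκQ : 0 < κQ) (hcF : 0 < cF) (hcV : 0 ≤ cV)
    (hB₁ : 0 < B₁) (hC : 0 < C) (hc : 0 < c) (hα₁ : 0 ≤ α₁) : 0 < kappa366 κQ cF cV B₀ B₁ C c α₁ := by
  unfold kappa366
  positivity

/-- **B9 p. 403, *"thus the operators in the equality are invertible and an inverse of the left-hand side can be expressed
by a Neumann series convergent for α₁ sufficiently small. … The inverse satisfies Theorem 3.2"* — with BOTH by-reference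
steps of the display discharged**: (3.65) (the expansion, `B9Eq360Vprime.eq365b`) and (3.66) (this file).  This is
`B9Thm34Inv.inverse_satisfies_thm32` (which took (3.65) as `h365` and (3.66) as `h366`) fed by `eq365_cornerR` and
`ineq366_kernel`.  DATA: the seven letters embedded in the functions on `T_η ⊕ 𝔅` (block map `Sum.elim blk id`) with (3.57)
`Q′(U′U) = Q′(U) + F′₂(A)`, `Q′*(U′U) = Q′*(U) + F′₂*(A)` and (3.65)₁,₂ for `E = G′(U′U)` (`h357`, `h357s`, `h365l`, `h365r`);
`L := Q′G′²Q′*` on 𝔅 (the corner) with the inverse `Linv` of Theorem 3.2 (`hL`, (3.48) `h348` with constants `B₀`, `δ₀`).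
INPUTS of printed shape: block-locality of `Q′`, `Q′*` (norm `κ_Q`), (3.59) for `F′₂`, `F′₂*` (`c_F α₁`), Theorem 3.1 (3.42)₁
for `G′(U)` (`B₀′`) and `G′(U′U)` (`B₁`), (3.63) for `V′G′(U)`, `V′G′(U′U)` (`c_V`), at a common rate `δ` with
`½δ₀ + (α₂+β₂)δ₀ ≦ δ`; Lemma 2.1 of [4] at the exponent/rate pairs of `B9Thm34Inv` ((½+α, δ₀), (α′, (½−α)δ₀), scale transfer
at `α` for `(Lʲη)^{−4}` with constant `C`) and of this file ((β₂, δ₀), scale transfer at `α₂` for `(Lʲη)²` with constant `C₂`);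
the distance axioms; and the EXPLICIT smallness `α₁ ≦ a₁ := (2κ₃₆₆B₀Cc₁(δ₀,½+α)·c₁((½−α)δ₀,α′))⁻¹` (κ₃₆₆ = `kappa366 …`,
which contains `α₁` through the bounded factors `c_Fα₁`, `c_Vα₁` — for `α₁ ≦ 1` replace it by its value at `α₁ = 1`).
CONCLUSION: `L′ = Q′(U′U)G′²(U′U)Q′*(U′U)` (on 𝔅) has a two-sided inverse `T` with
`|T(y,y′)| ≦ 2B₀c₁((½−α)δ₀,α′)(Lʲη)^{−4}(L^{j′}η)^{−d}e^{−(1−α′)(½−α)δ₀d(y,y′)}` — (3.48) at `U′U` with the constants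
`B₁′ = 2B₀c₁`, `δ₁′ = (1−α′)(½−α)δ₀` of `B9Thm34Inv`, now resting on Theorems 3.1/3.2 (as hypotheses of their printed shape),
(3.57)/(3.59), (3.61)⇒(3.63), (3.65) and Lemma 2.1 only.
[cite: Balaban1985BackgroundPropagators, Thm 3.2 (3.48) p.398 + (3.57)–(3.59) pp.401–402 + (3.63)–(3.67) pp.402–403 + Thm 3.4 p.400; Balaban1984PropagatorsII, Lemma 2.1 p.234] -/
theorem inverse_satisfies_thm32_of_parts (blk : X → g.Site) (d : ℕ)
    (δ₀ δ α α' α₂ β₂ C C₂ κQ cF cV B₀ B₀' B₁ α₁ : ℝ)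
    (hδ₀ : 0 < δ₀) (hα0 : 0 < α) (hα : α < 1 / 2) (hα' : α' < 1)
    (hB₀ : 0 < B₀) (hC : 0 < C) (hα₁ : 0 ≤ α₁)
    (hκQ : 0 < κQ) (hcF : 0 < cF) (hcV : 0 ≤ cV) (hB₀' : 0 ≤ B₀') (hB₁ : 0 < B₁) (hC₂ : 0 < C₂)
    (hα₂ : 0 ≤ α₂) (hβ₂ : 0 ≤ β₂) (hr : δ₀ / 2 + (α₂ + β₂) * δ₀ ≤ δ)
    (hc₁ : 0 < B6.c1 d δ₀ (1 / 2 + α)) (hc₁' : 0 < B6.c1 d ((1 / 2 - α) * δ₀) α') (hc₂ : 0 < B6.c1 d δ₀ β₂)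
    (htri : Triangle254 (toB6 g R H)) (hsymm : ∀ a b : g.Site, g.dist a b = g.dist b a)
    (hrefl : ∀ y : g.Site, g.dist y y = 0) (hdnn : ∀ a b : g.Site, 0 ≤ g.dist a b)
    (hlen : ∀ y : g.Site, 0 < g.len y)
    (hST : ScaleTransfer g δ₀ α C (fun y => g.len y ^ (-(4 : ℝ))))
    (hST₂ : ScaleTransfer g δ₀ α₂ C₂ (fun y => g.len y ^ 2))
    (h261 : Ineq261 d (toB6 g R H) δ₀ (1 / 2 + α))
    (h261' : Ineq261 d (toB6 g R H) ((1 / 2 - α) * δ₀) α')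
    (h261₂ : Ineq261 d (toB6 g R H) δ₀ β₂)
    (ha₁ : α₁ ≤ (2 * (kappa366 κQ cF cV B₀' B₁ C₂ (B6.c1 d δ₀ β₂) α₁ * B₀ * C * B6.c1 d δ₀ (1 / 2 + α)) *
      B6.c1 d ((1 / 2 - α) * δ₀) α')⁻¹)
    {Q Q' Qs Qs' F₂ F₂s G E V : Module.End ℝ (X ⊕ g.Site → ℝ)} {Linv : Module.End ℝ (g.Site → ℝ)}
    (h357 : Q' = Q + F₂) (h357s : Qs' = Qs + F₂s) (h365l : E = G + G * V * E) (h365r : E = G + E * V * G)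
    (hL : cornerR (Q * (G * G) * Qs) * Linv = 1)
    (h348 : ∀ y y' : g.Site, |B9Thm34Inv.ker (B9Thm34Inv.vol g d) Linv y y'| ≤
      B₀ * g.len y ^ (-(4 : ℝ)) * g.len y' ^ (-(d : ℝ)) * Real.exp (-(δ₀ * g.dist y y')))
    (hQ : HasMajorant (g := toB6 g R H) (Sum.elim blk fun y : g.Site => y) Q
      (fun a b : g.Site => if a = b then κQ else 0))
    (hQs : HasMajorant (g := toB6 g R H) (Sum.elim blk fun y : g.Site => y) Qs
      (fun a b : g.Site => if a = b then κQ else 0))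
    (hF : HasMajorant (g := toB6 g R H) (Sum.elim blk fun y : g.Site => y) F₂
      (fun a b : g.Site => if a = b then cF * α₁ else 0))
    (hFs : HasMajorant (g := toB6 g R H) (Sum.elim blk fun y : g.Site => y) F₂s
      (fun a b : g.Site => if a = b then cF * α₁ else 0))
    (hG : HasMajorant (g := toB6 g R H) (Sum.elim blk fun y : g.Site => y) G
      (fun a b => B₀' * g.len a ^ 2 * Real.exp (-(δ * g.dist a b))))
    (hE : HasMajorant (g := toB6 g R H) (Sum.elim blk fun y : g.Site => y) E
      (fun a b => B₁ * g.len a ^ 2 * Real.exp (-(δ * g.dist a b))))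
    (hVG : HasMajorant (g := toB6 g R H) (Sum.elim blk fun y : g.Site => y) (V * G)
      (fun a b => cV * α₁ * B₀' * Real.exp (-(δ * g.dist a b))))
    (hVE : HasMajorant (g := toB6 g R H) (Sum.elim blk fun y : g.Site => y) (V * E)
      (fun a b => cV * α₁ * B₁ * Real.exp (-(δ * g.dist a b)))) :
    ∃ T : Module.End ℝ (g.Site → ℝ), T * cornerR (Q' * (E * E) * Qs') = 1 ∧ cornerR (Q' * (E * E) * Qs') * T = 1 ∧
      ∀ y y' : g.Site, |B9Thm34Inv.ker (B9Thm34Inv.vol g d) T y y'| ≤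
        2 * B₀ * B6.c1 d ((1 / 2 - α) * δ₀) α' * g.len y ^ (-(4 : ℝ)) * g.len y' ^ (-(d : ℝ)) *
          Real.exp (-((1 - α') * ((1 / 2 - α) * δ₀) * g.dist y y')) := by
  have hκ : 0 < kappa366 κQ cF cV B₀' B₁ C₂ (B6.c1 d δ₀ β₂) α₁ := kappa366_pos hκQ hcF hcV hB₁ hC₂ hc₂ hα₁
  have h366 := ineq366_kernel (R := R) (H := H) blk d δ₀ δ α₂ β₂ (δ₀ / 2) C₂ κQ cF cV B₀' B₁ α₁ hκQ.le hcF.le hcV hB₀'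
    hB₁.le hα₁ hC₂.le (by linarith) (mul_nonneg hα₂ hδ₀.le) (mul_nonneg hβ₂ hδ₀.le) hr hdnn htri hlen hST₂ h261₂
    hQ hQs hF hFs hG hE hVG hVE
  have h366' : ∀ y y' : g.Site,
      |B9Thm34Inv.ker (B9Thm34Inv.vol g d) (cornerR (B9Eq360Vprime.cPrime Q Qs F₂ F₂s G E V)) y y'| ≤
        kappa366 κQ cF cV B₀' B₁ C₂ (B6.c1 d δ₀ β₂) α₁ * α₁ * g.len y ^ (4 : ℝ) * g.len y' ^ (-(d : ℝ)) *
          Real.exp (-(δ₀ / 2 * g.dist y y')) := by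
    intro y y'
    have h4 : g.len y ^ (4 : ℝ) = g.len y ^ 4 := by
      rw [show (4 : ℝ) = ((4 : ℕ) : ℝ) by norm_num, Real.rpow_natCast]
    rw [h4]
    exact h366 y y'
  exact B9Thm34Inv.inverse_satisfies_thm32 (R := R) (H := H) d δ₀ α α'
    (kappa366 κQ cF cV B₀' B₁ C₂ (B6.c1 d δ₀ β₂) α₁) B₀ C α₁ hδ₀ hα0 hα hα' hκ hB₀ hC hα₁ hc₁ hc₁' htri hsymm hrefl
    hdnn hlen hST h261 h261' ha₁ hL h348 (eq365_cornerR h357 h357s h365l h365r) h366'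

end SectBStep

/-! ## §6  (v1.1) The dictionary to the TWO-SPACE letters: `C′(A)` as the operator on the functions on 𝔅 built from
`Q′, F′₂ : (sites) → (blocks)`, `Q′*, F′₂* : (blocks) → (sites)`, `G′(U), G′(U′U), V′(A)` on sites — the letters embedded
in the functions on `T_η ⊕ 𝔅` by `B6RandomWalkHom.emb` / `embL`, the corner computed, the majorants transported -/

section Hetero

variable {X Y : Type}

open Literature.MathematicalPhysics.QuantumFieldTheory.Balaban1983to89.B6RandomWalkHom (HasMajorantHom
  hasMajorant_emb hasMajorant_embL_right hasMajorantHom_zero emb_mul)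

/-- **`C′(A)` as an operator on the functions on 𝔅, from the two-space letters** — the p. 403 sum
`F′₂G′²(U′U)Q′* + Q′G′²(U′U)F′₂* + F′₂G′²(U′U)F′₂* + Q′G′(U′U)V′G′²(U)Q′* + Q′G′²(U)V′G′(U′U)Q′* + Q′G′(U)V′G′²(U′U)V′G′(U)Q′*`
with `Q′, F′₂ : (X → ℝ) → (𝔅 → ℝ)` ((3.19), (3.59)), `Q′*, F′₂* : (𝔅 → ℝ) → (X → ℝ)`, `G′(U), G′(U′U), V′(A)` endomorphisms
of the site functions; = the 𝔅-corner of `B9Eq360Vprime.cPrime` of the embedded letters (`cornerR_cPrime_emb`).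
[cite: Balaban1985BackgroundPropagators, (3.65)–(3.66) p.403] -/
def cPrimeHom (Q F₂ : (X → ℝ) →ₗ[ℝ] (Y → ℝ)) (Qs F₂s : (Y → ℝ) →ₗ[ℝ] (X → ℝ)) (G E V : Module.End ℝ (X → ℝ)) :
    Module.End ℝ (Y → ℝ) :=
  F₂ ∘ₗ (E * E) ∘ₗ Qs + Q ∘ₗ (E * E) ∘ₗ F₂s + F₂ ∘ₗ (E * E) ∘ₗ F₂s + Q ∘ₗ (E * V * (G * G)) ∘ₗ Qs
    + Q ∘ₗ (G * G * V * E) ∘ₗ Qs + Q ∘ₗ (G * V * (E * E) * V * G) ∘ₗ Qs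

/-- Evaluation of `(R 0; S 0)`. [folklore] -/
private theorem emb_apply_eq (R : Module.End ℝ (X → ℝ)) (S : (X → ℝ) →ₗ[ℝ] (Y → ℝ)) (f : X ⊕ Y → ℝ) :
    B6RandomWalkHom.emb R S f = Sum.elim (R (f ∘ Sum.inl)) (S (f ∘ Sum.inl)) := rfl

/-- Evaluation of `(V T; 0 0)`. [folklore] -/
private theorem embL_apply_eq (V : Module.End ℝ (X → ℝ)) (T : (Y → ℝ) →ₗ[ℝ] (X → ℝ)) (f : X ⊕ Y → ℝ) :
    B6RandomWalkHom.embL V T f = Sum.elim (V (f ∘ Sum.inl) + T (f ∘ Sum.inr)) 0 := rfl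

/-- **The 𝔅-corner of the embedded p. 403 sum is `C′(A)` on the block functions**: with `Q′ ↦ (0 0; Q′ 0)`,
`Q′* ↦ (0 Q′*; 0 0)`, `F′₂ ↦ (0 0; F′₂ 0)`, `F′₂* ↦ (0 F′₂*; 0 0)`, `G′, G′(U′U), V′ ↦ (· 0; 0 0)` on the functions on
`X ⊕ 𝔅`, `cornerR (cPrime …) = cPrimeHom …`. [cite: Balaban1985BackgroundPropagators, (3.65)–(3.66) p.403] -/
theorem cornerR_cPrime_emb (Q F₂ : (X → ℝ) →ₗ[ℝ] (Y → ℝ)) (Qs F₂s : (Y → ℝ) →ₗ[ℝ] (X → ℝ))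
    (G E V : Module.End ℝ (X → ℝ)) :
    cornerR (B9Eq360Vprime.cPrime (B6RandomWalkHom.emb 0 Q) (B6RandomWalkHom.embL 0 Qs) (B6RandomWalkHom.emb 0 F₂)
        (B6RandomWalkHom.embL 0 F₂s) (B6RandomWalkHom.emb G 0) (B6RandomWalkHom.emb E 0) (B6RandomWalkHom.emb V 0))
      = cPrimeHom Q F₂ Qs F₂s G E V := by
  apply LinearMap.ext
  intro ν
  funext y
  simp [cornerR_apply, cPrimeHom, B9Eq360Vprime.cPrime, emb_apply_eq, embL_apply_eq, Module.End.mul_apply]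

variable {g : B9.Geometry} [Fintype g.Site] {R : ℝ} {H : Prop}

/-- An endomorphism of the site functions with majorant `K ≧ 0` embeds as `(· 0; 0 0)` with the same majorant for the
block map `Sum.elim blk id`. [cite: Balaban1984PropagatorsII, (2.51) p.232] -/
theorem hasMajorant_emb_site (blk : X → g.Site) {T : Module.End ℝ (X → ℝ)} {K : g.Site → g.Site → ℝ}
    (hK : ∀ a b, 0 ≤ K a b) (h : HasMajorant (g := toB6 g R H) blk T K) :
    HasMajorant (g := toB6 g R H) (Sum.elim blk fun y : g.Site => y) (B6RandomWalkHom.emb T 0) K :=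
  hasMajorant_emb (g := toB6 g R H) h (hasMajorantHom_zero (g := toB6 g R H) _ _) (fun _ _ => le_rfl) hK

/-- A product of two site endomorphisms embeds as the product of the embeddings (`emb_mul`), so a majorant of `V′G′`
is one of `(V′ 0; 0 0)(G′ 0; 0 0)`. [cite: Balaban1984PropagatorsII, (2.52) p.232] -/
theorem hasMajorant_emb_site_mul (blk : X → g.Site) {V T : Module.End ℝ (X → ℝ)} {K : g.Site → g.Site → ℝ}
    (hK : ∀ a b, 0 ≤ K a b) (h : HasMajorant (g := toB6 g R H) blk (V * T) K) :
    HasMajorant (g := toB6 g R H) (Sum.elim blk fun y : g.Site => y)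
      (B6RandomWalkHom.emb V 0 * B6RandomWalkHom.emb T 0) K := by
  rw [emb_mul, LinearMap.zero_comp]
  exact hasMajorant_emb_site (R := R) (H := H) blk hK h

/-- A sites-to-blocks letter (`Q′`, `F′₂`) with two-space majorant `K ≧ 0` embeds as `(0 0; · 0)` with the same
majorant. [cite: Balaban1984PropagatorsII, (2.51) p.232] -/
theorem hasMajorant_emb_toBlocks (blk : X → g.Site) {S : (X → ℝ) →ₗ[ℝ] (g.Site → ℝ)} {K : g.Site → g.Site → ℝ}
    (hK : ∀ a b, 0 ≤ K a b) (h : HasMajorantHom (g := toB6 g R H) blk (fun y : g.Site => y) S K) :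
    HasMajorant (g := toB6 g R H) (Sum.elim blk fun y : g.Site => y) (B6RandomWalkHom.emb 0 S) K :=
  hasMajorant_emb (g := toB6 g R H) (B6RandomWalk.hasMajorant_zero (g := toB6 g R H) blk) h hK (fun _ _ => le_rfl)

/-- A blocks-to-sites letter (`Q′*`, `F′₂*`) with two-space majorant `K ≧ 0` embeds as `(0 ·; 0 0)` with the same
majorant. [cite: Balaban1984PropagatorsII, (2.51) p.232] -/
theorem hasMajorant_embL_toSites (blk : X → g.Site) {T : (g.Site → ℝ) →ₗ[ℝ] (X → ℝ)} {K : g.Site → g.Site → ℝ}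
    (hK : ∀ a b, 0 ≤ K a b) (h : HasMajorantHom (g := toB6 g R H) (fun y : g.Site => y) blk T K) :
    HasMajorant (g := toB6 g R H) (Sum.elim blk fun y : g.Site => y) (B6RandomWalkHom.embL 0 T) K :=
  hasMajorant_embL_right (g := toB6 g R H) h hK

variable [DecidableEq g.Site]

/-- **(3.66) FOR THE TWO-SPACE LETTERS** — the form in which the tree supplies the inputs: `Q′ = B9Eq319Avg.avgOp`,
`Q′* = B9Eq319Avg.injOp` with their block-diagonal two-space majorants `κ_Q·𝟙[y = y′]`
(`B9Eq319Avg.avgOp_hasMajorantHom_b9` / `injOp_hasMajorantHom_b9`), `F′₂`, `F′₂*` likewise with `c_Fα₁` ((3.59)),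
Theorem 3.1 (3.42)₁ for `G′(U)`, `G′(U′U)` as `B6RandomWalk.HasMajorant blk`, (3.63) for `V′G′(U)`, `V′G′(U′U)`
(`B6RandomWalkHom.b9_363_of_361`): the operator `C′(A)` on the functions on 𝔅 (`cPrimeHom`) has the majorant
`κ₃₆₆α₁(Lʲη)⁴e^{−ρ d(y,y′)}` for the identity block map — i.e. `|C′(A;y,y′)| ≦ κ₃₆₆α₁(Lʲη)⁴(L^{j′}η)^{−d}e^{−ρ d(y,y′)}`
(`ineq366_kernel_hom`). [cite: Balaban1985BackgroundPropagators, (3.65)–(3.66) p.403 + (3.19) p.393 + (3.59) p.402 + (3.63) p.402 + Thm 3.1 (3.42) p.397; Balaban1984PropagatorsII, Lemma 2.1 p.234] -/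
theorem hasMajorant_cPrimeHom (blk : X → g.Site) (d : ℕ) (δ₀ δ α β ρ C κQ cF cV B₀ B₁ α₁ : ℝ)
    (hκQ : 0 ≤ κQ) (hcF : 0 ≤ cF) (hcV : 0 ≤ cV) (hB₀ : 0 ≤ B₀) (hB₁ : 0 ≤ B₁) (hα₁ : 0 ≤ α₁) (hC : 0 ≤ C)
    (hρ : 0 ≤ ρ) (hαδ : 0 ≤ α * δ₀) (hβδ : 0 ≤ β * δ₀) (hr : ρ + (α + β) * δ₀ ≤ δ)
    (hdnn : ∀ a b : g.Site, 0 ≤ g.dist a b) (htri : Triangle254 (toB6 g R H))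
    (hST : ScaleTransfer g δ₀ α C (fun y => g.len y ^ 2)) (h261 : Ineq261 d (toB6 g R H) δ₀ β)
    {Q F₂ : (X → ℝ) →ₗ[ℝ] (g.Site → ℝ)} {Qs F₂s : (g.Site → ℝ) →ₗ[ℝ] (X → ℝ)} {G E V : Module.End ℝ (X → ℝ)}
    (hQ : HasMajorantHom (g := toB6 g R H) blk (fun y : g.Site => y) Q
      (fun a b : g.Site => κQ * (if a = b then (1 : ℝ) else 0)))
    (hQs : HasMajorantHom (g := toB6 g R H) (fun y : g.Site => y) blk Qs
      (fun a b : g.Site => κQ * (if a = b then (1 : ℝ) else 0)))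
    (hF : HasMajorantHom (g := toB6 g R H) blk (fun y : g.Site => y) F₂
      (fun a b : g.Site => cF * α₁ * (if a = b then (1 : ℝ) else 0)))
    (hFs : HasMajorantHom (g := toB6 g R H) (fun y : g.Site => y) blk F₂s
      (fun a b : g.Site => cF * α₁ * (if a = b then (1 : ℝ) else 0)))
    (hG : HasMajorant (g := toB6 g R H) blk G (fun a b => B₀ * g.len a ^ 2 * Real.exp (-(δ * g.dist a b))))
    (hE : HasMajorant (g := toB6 g R H) blk E (fun a b => B₁ * g.len a ^ 2 * Real.exp (-(δ * g.dist a b))))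
    (hVG : HasMajorant (g := toB6 g R H) blk (V * G) (fun a b => cV * α₁ * B₀ * Real.exp (-(δ * g.dist a b))))
    (hVE : HasMajorant (g := toB6 g R H) blk (V * E) (fun a b => cV * α₁ * B₁ * Real.exp (-(δ * g.dist a b)))) :
    HasMajorant (g := toB6 g R H) (fun y : g.Site => y) (cPrimeHom Q F₂ Qs F₂s G E V)
      (fun a b => kappa366 κQ cF cV B₀ B₁ C (B6.c1 d δ₀ β) α₁ * α₁ * g.len a ^ 4 * Real.exp (-(ρ * g.dist a b))) := by
  have hcFα : 0 ≤ cF * α₁ := mul_nonneg hcF hα₁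
  -- the block-diagonal majorants in the `if … then κ else 0` form
  have hind : ∀ κ : ℝ, (fun a b : g.Site => κ * (if a = b then (1 : ℝ) else 0)) =
      fun a b : g.Site => if a = b then κ else 0 := fun κ => by
    funext a b
    split_ifs <;> simp
  rw [hind] at hQ hQs hF hFs
  have hKQ : ∀ a b : g.Site, 0 ≤ (fun a b : g.Site => if a = b then κQ else 0) a b := fun a b => by
    show 0 ≤ (if a = b then κQ else 0)
    split_ifs
    · exact hκQ
    · exact le_rfl
  have hKF : ∀ a b : g.Site, 0 ≤ (fun a b : g.Site => if a = b then cF * α₁ else 0) a b := fun a b => by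
    show 0 ≤ (if a = b then cF * α₁ else 0)
    split_ifs
    · exact hcFα
    · exact le_rfl
  have hKG : ∀ a b : g.Site, 0 ≤ B₀ * g.len a ^ 2 * Real.exp (-(δ * g.dist a b)) := fun a b => by positivity
  have hKE : ∀ a b : g.Site, 0 ≤ B₁ * g.len a ^ 2 * Real.exp (-(δ * g.dist a b)) := fun a b => by positivity
  have hKVG : ∀ a b : g.Site, 0 ≤ cV * α₁ * B₀ * Real.exp (-(δ * g.dist a b)) := fun a b => by positivity
  have hKVE : ∀ a b : g.Site, 0 ≤ cV * α₁ * B₁ * Real.exp (-(δ * g.dist a b)) := fun a b => by positivity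
  rw [← cornerR_cPrime_emb]
  exact hasMajorant_cornerR_cPrime (R := R) (H := H) blk d δ₀ δ α β ρ C κQ cF cV B₀ B₁ α₁ hκQ hcF hcV hB₀ hB₁ hα₁ hC
    hρ hαδ hβδ hr hdnn htri hST h261
    (hasMajorant_emb_toBlocks (R := R) (H := H) blk hKQ hQ) (hasMajorant_embL_toSites (R := R) (H := H) blk hKQ hQs)
    (hasMajorant_emb_toBlocks (R := R) (H := H) blk hKF hF) (hasMajorant_embL_toSites (R := R) (H := H) blk hKF hFs)
    (hasMajorant_emb_site (R := R) (H := H) blk hKG hG) (hasMajorant_emb_site (R := R) (H := H) blk hKE hE)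
    (hasMajorant_emb_site_mul (R := R) (H := H) blk hKVG hVG) (hasMajorant_emb_site_mul (R := R) (H := H) blk hKVE hVE)

/-- **(3.66) for the two-space letters, printed kernel notation**: `|C′(A;y,y′)| ≦ κ₃₆₆α₁(Lʲη)⁴(L^{j′}η)^{−d}e^{−ρ d(y,y′)}`
for the kernel of `cPrimeHom` with respect to the pairing weight `(L^{j′}η)^d` (`B9Thm34Inv.ker (vol g d)`).
[cite: Balaban1985BackgroundPropagators, (3.66) p.403] -/
theorem ineq366_kernel_hom (blk : X → g.Site) (d : ℕ) (δ₀ δ α β ρ C κQ cF cV B₀ B₁ α₁ : ℝ)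
    (hκQ : 0 ≤ κQ) (hcF : 0 ≤ cF) (hcV : 0 ≤ cV) (hB₀ : 0 ≤ B₀) (hB₁ : 0 ≤ B₁) (hα₁ : 0 ≤ α₁) (hC : 0 ≤ C)
    (hρ : 0 ≤ ρ) (hαδ : 0 ≤ α * δ₀) (hβδ : 0 ≤ β * δ₀) (hr : ρ + (α + β) * δ₀ ≤ δ)
    (hdnn : ∀ a b : g.Site, 0 ≤ g.dist a b) (htri : Triangle254 (toB6 g R H))
    (hlen : ∀ y : g.Site, 0 < g.len y)
    (hST : ScaleTransfer g δ₀ α C (fun y => g.len y ^ 2)) (h261 : Ineq261 d (toB6 g R H) δ₀ β)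
    {Q F₂ : (X → ℝ) →ₗ[ℝ] (g.Site → ℝ)} {Qs F₂s : (g.Site → ℝ) →ₗ[ℝ] (X → ℝ)} {G E V : Module.End ℝ (X → ℝ)}
    (hQ : HasMajorantHom (g := toB6 g R H) blk (fun y : g.Site => y) Q
      (fun a b : g.Site => κQ * (if a = b then (1 : ℝ) else 0)))
    (hQs : HasMajorantHom (g := toB6 g R H) (fun y : g.Site => y) blk Qs
      (fun a b : g.Site => κQ * (if a = b then (1 : ℝ) else 0)))
    (hF : HasMajorantHom (g := toB6 g R H) blk (fun y : g.Site => y) F₂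
      (fun a b : g.Site => cF * α₁ * (if a = b then (1 : ℝ) else 0)))
    (hFs : HasMajorantHom (g := toB6 g R H) (fun y : g.Site => y) blk F₂s
      (fun a b : g.Site => cF * α₁ * (if a = b then (1 : ℝ) else 0)))
    (hG : HasMajorant (g := toB6 g R H) blk G (fun a b => B₀ * g.len a ^ 2 * Real.exp (-(δ * g.dist a b))))
    (hE : HasMajorant (g := toB6 g R H) blk E (fun a b => B₁ * g.len a ^ 2 * Real.exp (-(δ * g.dist a b))))
    (hVG : HasMajorant (g := toB6 g R H) blk (V * G) (fun a b => cV * α₁ * B₀ * Real.exp (-(δ * g.dist a b))))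
    (hVE : HasMajorant (g := toB6 g R H) blk (V * E) (fun a b => cV * α₁ * B₁ * Real.exp (-(δ * g.dist a b)))) :
    ∀ y y' : g.Site,
      |B9Thm34Inv.ker (B9Thm34Inv.vol g d) (cPrimeHom Q F₂ Qs F₂s G E V) y y'| ≤
        kappa366 κQ cF cV B₀ B₁ C (B6.c1 d δ₀ β) α₁ * α₁ * g.len y ^ 4 * g.len y' ^ (-(d : ℝ)) *
          Real.exp (-(ρ * g.dist y y')) := by
  intro y y'
  have hM := hasMajorant_cPrimeHom (R := R) (H := H) blk d δ₀ δ α β ρ C κQ cF cV B₀ B₁ α₁ hκQ hcF hcV hB₀ hB₁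
    hα₁ hC hρ hαδ hβδ hr hdnn htri hST h261 hQ hQs hF hFs hG hE hVG hVE
  have hent := (B9Thm34Inv.hasMajorant_id_iff (R := R) (H := H) _ _).mp hM y y'
  have hk := (B9Thm34Inv.ker_le_iff (B9Thm34Inv.vol g d) (B9Thm34Inv.vol_pos d hlen y') _ y _).mpr hent
  rw [B9Thm34Inv.vol_inv d hlen] at hk
  calc |B9Thm34Inv.ker (B9Thm34Inv.vol g d) (cPrimeHom Q F₂ Qs F₂s G E V) y y'|
      ≤ kappa366 κQ cF cV B₀ B₁ C (B6.c1 d δ₀ β) α₁ * α₁ * g.len y ^ 4 * Real.exp (-(ρ * g.dist y y')) *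
          g.len y' ^ (-(d : ℝ)) := hk
    _ = _ := by ring

end Hetero

end Literature.MathematicalPhysics.QuantumFieldTheory.Balaban1983to89.B9Ineq366CPrime

end
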